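import Literature.Probability.RandomPlanarGeometry.SAWKestenMeasureRate
import Literature.Probability.RandomPlanarGeometry.SAWKestenBridgeMeasure
import Literature.Probability.RandomPlanarGeometry.SAWKestenBridgeIdentities
import Literature.Probability.RandomPlanarGeometry.SAWBridgeRatioRateZ2
import Literature.Probability.RandomPlanarGeometry.SAWPositiveWalks
import Mathlib.Topology.Algebra.InfiniteSum.NatInt
import HarnessLib

/-!
# Kesten's infinite-bridge measure with a rate, III: Theorem 8.3.1 quantified

Topic `Literature/Probability/RandomPlanarGeometry` (continues `SAWKestenMeasureRate.lean`,
`SAWKestenBridgeMeasure.lean`, `SAWKestenBridgeIdentities.lean`).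

Source: N. Madras, G. Slade, *The Self-Avoiding Walk* (1993), Theorem 8.3.1 (book p. 273; held text
`book:madras1993-self-avoiding-walk` p0285:L35–37): for an `m`-step self-avoiding walk `ω` the fraction
`P^B_{m,n}(ω)` of `n`-step bridges extending `ω` converges, as `n → ∞`, to `P^B_m(ω) = Σ_k |E_k(ω)| μ^{-k}`
((8.3.3), (8.3.6)); proof pp. 273–275 by Fatou / lim sup ((8.3.7)–(8.3.13)); §8.5 Notes p. 279: "The
results of this section are new." NO RATE is printed.

## What is new in this file (not in print)

`kestenCyl_rate` (the lane's R25b): there is `K` with, for all `m ≤ n`, `n ≥ 2` and every `m`-step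
self-avoiding walk `ω` on `ℤ^{d+2}`,
`|P^B_{m,n}(ω) - P^B_m(ω)| ≤ K · log(m+2) / log n`.
The rate is `K'/log n` uniformly in the regime `2(m+1) ≤ n^{1/5}`; the factor `log(m+2)` only makes the
bound trivial (`≥ 1`) outside it. Mechanism = the printed proof with the lim sups replaced by the
quantitative inputs of `SAWKestenMeasureRate.lean`: truncation at `J = m + T = ⌊n^{1/5}⌋` ((8.3.7),
(8.3.9): `SAW.MS831.sum_trunc_le` / `sum_tail_le`), the uniform ratio lemma `ratio_uniform` on `k ≤ J`,
the head/tail control `firstBreakLaw_head_tail` of the first-break-point law at the shifted lengths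
`n - i` (`i ≤ m`), the explicit Kesten tail `kestenTail_le`, and the normalisation `Σ_ω P^B_m(ω) = 1`
(`sum_kestenCyl_eq_one`, giving `P^B_m(ω) ≤ 1`).
-/

noncomputable section

open Finset Filter Topology Literature.Probability.LatticeModels Literature.Probability.Percolation
open scoped BigOperators

namespace Literature.Probability.RandomPlanarGeometry.SAW.Zd

variable {d : ℕ} [NeZero d]

/-! ### The cylinder weights as a convergent series; `0 ≤ P^B_m(ω) ≤ 1` -/

/-- For `m ≥ 1` and an `m`-step self-avoiding walk `ω` on `ℤ^{d+2}`, the series (8.3.6) converges: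
`HasSum (k ↦ |E_k(ω)|/μ^k) (P^B_m(ω))`. [cite: MadrasSlade1993, Theorem 8.3.1, eq. (8.3.6)] -/
theorem hasSum_kestenCyl {d m : ℕ} (hm : 1 ≤ m) {ω : ℕ → Site (d + 2)} (hω : ω ∈ saws (d + 2) m) :
    HasSum (fun k => (eCount (d + 2) k m ω : ℝ) / connectiveConstant (d + 2) ^ k)
      (kestenCyl (d + 2) m ω) := by
  rw [kestenCyl_eq_tsum_div]
  exact (MadrasSlade1993_thm831 hm hω).1.hasSum

/-- `0 ≤ P^B_m(ω) ≤ 1` for `m ≥ 1` and `ω ∈ S_m` (the upper bound from the normalisation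
`Σ_{ω ∈ S_m} P^B_m(ω) = 1`). [cite: MadrasSlade1993, §8.3, p. 273] -/
theorem kestenCyl_mem_Icc {d m : ℕ} (hm : 1 ≤ m) {ω : ℕ → Site (d + 2)} (hω : ω ∈ saws (d + 2) m) :
    kestenCyl (d + 2) m ω ∈ Set.Icc (0 : ℝ) 1 := by
  have hnn : ∀ ω' : ℕ → Site (d + 2), 0 ≤ kestenCyl (d + 2) m ω' := fun ω' => by
    rw [kestenCyl_eq_tsum_div]
    exact tsum_nonneg fun k => by
      have := connectiveConstant_pos (d + 2)
      positivity
  refine ⟨hnn ω, ?_⟩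
  have h1 := sum_kestenCyl_eq_one (d + 2) m hm
  have : kestenCyl (d + 2) m ω ≤ ∑ ω' ∈ saws (d + 2) m, kestenCyl (d + 2) m ω' :=
    Finset.single_le_sum (f := fun ω' => kestenCyl (d + 2) m ω') (fun ω' _ => hnn ω') hω
  linarith

/-! ### The trivial cylinder `m = 0` -/

/-- For the `0`-step walk: every `n`-step bridge extends it. [cite: MadrasSlade1993, §8.3, eq. (8.3.2)] -/
theorem bridgeExtCount_zero_left (n : ℕ) {ω : ℕ → Site d} (hω : ω ∈ saws d 0) :
    bridgeExtCount d n 0 ω = bridgeCount d n := by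
  classical
  have hω0 : ω 0 = 0 := (mem_saws.1 hω).1
  unfold bridgeExtCount bridgeCount
  congr 1
  refine Finset.filter_true_of_mem fun β hβ j hj => ?_
  obtain rfl : j = 0 := Nat.le_zero.1 hj
  rw [hω0]
  exact (mem_saws.1 (mem_bridges.1 hβ).1).1

/-- For the `0`-step walk: `|E_0(ω)| = 1` and `|E_k(ω)| = 0` for `k ≥ 1` (the time `0` is a break point),
so `P^B_0(ω) = 1`. [cite: MadrasSlade1993, §8.3, eq. (8.3.6)] -/
theorem kestenCyl_zero_left {ω : ℕ → Site d} (hω : ω ∈ saws d 0) : kestenCyl d 0 ω = 1 := by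
  classical
  have hω0 : ω 0 = 0 := (mem_saws.1 hω).1
  have he0 : eCount d 0 0 ω = 1 := by
    unfold eCount
    rw [bridges_zero]
    rw [Finset.card_eq_one]
    refine ⟨0, ?_⟩
    ext β
    simp only [Finset.mem_filter, Finset.mem_singleton]
    constructor
    · exact fun h => h.1
    · intro h
      subst h
      refine ⟨rfl, fun j hj => ?_, fun i _ hi => absurd hi (Nat.not_lt_zero i)⟩
      obtain rfl : j = 0 := Nat.le_zero.1 hj
      rw [hω0]; rfl
  have hek : ∀ k, k ≠ 0 → eCount d k 0 ω = 0 := by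
    intro k hk
    unfold eCount
    rw [Finset.card_eq_zero, Finset.filter_eq_empty_iff]
    intro β hβ h
    exact h.2 0 le_rfl (Nat.pos_of_ne_zero hk) (isRenewalTime_zero (mem_bridges.1 hβ).2)
  unfold kestenCyl
  rw [tsum_eq_single 0 fun k hk => by rw [hek k hk]; simp]
  rw [he0]; simp

/-! ### The quantitative Theorem 8.3.1 -/

/-- `Σ_{i ≤ m} μ^{-i} ≤ 2` for `μ ≥ 2`. [folklore] -/
private theorem sum_inv_pow_le_two {μ : ℝ} (hμ : 2 ≤ μ) (m : ℕ) :
    ∑ i ∈ Finset.range (m + 1), (μ ^ i)⁻¹ ≤ 2 := by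
  have hμ0 : 0 < μ := by linarith
  have h1 : ∀ i ∈ Finset.range (m + 1), (μ ^ i)⁻¹ ≤ (1 / 2 : ℝ) ^ i := by
    intro i _
    rw [one_div, inv_pow]
    exact inv_anti₀ (by positivity) (pow_le_pow_left₀ (by norm_num) hμ i)
  refine (Finset.sum_le_sum h1).trans ?_
  have hgeom := geom_sum_Ico_le_of_lt_one (show (0 : ℝ) ≤ 1 / 2 by norm_num) (show (1 : ℝ) / 2 < 1 by norm_num)
    (m := 0) (n := m + 1)
  rw [Finset.range_eq_Ico]
  refine hgeom.trans ?_
  norm_num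

/-- The renewal equation (4.2.2) over `ℝ`. [cite: MadrasSlade1993, §4.2, eq. (4.2.2)] -/
private theorem bridgeCount_eq_sum_Icc_real {n : ℕ} (hn : 1 ≤ n) :
    (bridgeCount d n : ℝ) = ∑ s ∈ Icc 1 n, (irreducibleBridgeCount d s : ℝ) * (bridgeCount d (n - s) : ℝ) := by
  exact_mod_cast bridgeCount_eq_sum_Icc (d := d) hn

/-- The tail of the first-break-point law at length `n'`, in the shape produced by (8.3.9):
`b_{n'} - Σ_{r ≤ T} λ_r b_{n'-r} = b_{n'} · Σ_{T < r ≤ n'} P_{n'}(r)` (`n' ≥ 1`, `T ≤ n'`).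
[cite: MadrasSlade1993, Theorem 8.3.1 (proof, eq. (8.3.9))] -/
private theorem sub_sum_eq_mul_tail {n' T : ℕ} (hn' : 1 ≤ n') (hT : T ≤ n') :
    (bridgeCount d n' : ℝ) - ∑ r ∈ Finset.range (T + 1), (irreducibleBridgeCount d r : ℝ) * bridgeCount d (n' - r) =
      (bridgeCount d n' : ℝ) *
        ∑ r ∈ Ico (T + 1) (n' + 1), (irreducibleBridgeCount d r : ℝ) * (bridgeCount d (n' - r) : ℝ) /
          bridgeCount d n' := by
  have hb : (0 : ℝ) < bridgeCount d n' := by exact_mod_cast one_le_bridgeCount (d := d) n'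
  have hfull := bridgeCount_eq_sum_Icc_real (d := d) hn'
  -- `Σ_{r ∈ range (T+1)} = Σ_{r ∈ Icc 1 T}` (the `r = 0` term vanishes) and `Icc 1 n' = Icc 1 T ∪ Ico (T+1) (n'+1)`
  have h0 : ∑ r ∈ Finset.range (T + 1), (irreducibleBridgeCount d r : ℝ) * bridgeCount d (n' - r) =
      ∑ r ∈ Icc 1 T, (irreducibleBridgeCount d r : ℝ) * bridgeCount d (n' - r) := by
    rw [Finset.range_eq_Ico, ← Finset.sum_Ico_consecutive _ (Nat.zero_le 1) (by omega : 1 ≤ T + 1),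
      Finset.sum_Ico_eq_sum_range, show 1 - 0 = 1 by rfl, Finset.sum_range_one]
    simp only [add_zero, irreducibleBridgeCount_zero, Nat.cast_zero, zero_mul, zero_add]
    rw [SAW.MS831.Icc_eq_Ico_succ]
  have hsplit : ∑ s ∈ Icc 1 n', (irreducibleBridgeCount d s : ℝ) * (bridgeCount d (n' - s) : ℝ) =
      ∑ s ∈ Icc 1 T, (irreducibleBridgeCount d s : ℝ) * (bridgeCount d (n' - s) : ℝ) +
        ∑ s ∈ Ico (T + 1) (n' + 1), (irreducibleBridgeCount d s : ℝ) * (bridgeCount d (n' - s) : ℝ) := by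
    rw [SAW.MS831.Icc_eq_Ico_succ, SAW.MS831.Icc_eq_Ico_succ]
    exact (Finset.sum_Ico_consecutive _ (by omega) (by omega)).symm
  rw [h0, Finset.mul_sum]
  have : ∀ r ∈ Ico (T + 1) (n' + 1), (bridgeCount d n' : ℝ) *
      ((irreducibleBridgeCount d r : ℝ) * (bridgeCount d (n' - r) : ℝ) / bridgeCount d n') =
      (irreducibleBridgeCount d r : ℝ) * (bridgeCount d (n' - r) : ℝ) := by
    intro r _
    field_simp
  rw [Finset.sum_congr rfl this]
  linarith

/-- `n'^{-1/4} ≤ 2 n^{-1/4}` when `n ≤ 2 n'` (`n, n' ≥ 1`). [folklore] -/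
private theorem rpow_neg_quarter_le_two_mul {n n' : ℕ} (hn : 1 ≤ n) (hn' : 1 ≤ n') (h2 : n ≤ 2 * n') :
    (n' : ℝ) ^ (-(1 : ℝ) / 4) ≤ 2 * (n : ℝ) ^ (-(1 : ℝ) / 4) := by
  have hn0 : (0 : ℝ) < n := by exact_mod_cast (show 0 < n by omega)
  have hn'0 : (0 : ℝ) < n' := by exact_mod_cast (show 0 < n' by omega)
  have hMr : (n : ℝ) / 2 ≤ n' := by
    have : (n : ℝ) ≤ 2 * n' := by exact_mod_cast h2
    linarith
  have h1 : (n' : ℝ) ^ (-(1 : ℝ) / 4) ≤ ((n : ℝ) / 2) ^ (-(1 : ℝ) / 4) :=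
    Real.rpow_le_rpow_of_nonpos (by positivity) hMr (by norm_num)
  have h2' : ((n : ℝ) / 2) ^ (-(1 : ℝ) / 4) = (n : ℝ) ^ (-(1 : ℝ) / 4) / (2 : ℝ) ^ (-(1 : ℝ) / 4) :=
    Real.div_rpow hn0.le (by norm_num) _
  have h3 : (1 / 2 : ℝ) ≤ (2 : ℝ) ^ (-(1 : ℝ) / 4) := by
    rw [show (-(1 : ℝ) / 4) = -((1 : ℝ) / 4) by ring, Real.rpow_neg (by norm_num), one_div]
    refine inv_anti₀ (by positivity) ?_
    calc (2 : ℝ) ^ ((1 : ℝ) / 4) ≤ (2 : ℝ) ^ (1 : ℝ) :=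
          Real.rpow_le_rpow_of_exponent_le (by norm_num) (by norm_num)
      _ = 2 := Real.rpow_one 2
  have h4 : 0 ≤ (n : ℝ) ^ (-(1 : ℝ) / 4) := Real.rpow_nonneg hn0.le _
  calc (n' : ℝ) ^ (-(1 : ℝ) / 4) ≤ (n : ℝ) ^ (-(1 : ℝ) / 4) / (2 : ℝ) ^ (-(1 : ℝ) / 4) := by
        rw [← h2']; exact h1
    _ ≤ (n : ℝ) ^ (-(1 : ℝ) / 4) / (1 / 2) := div_le_div_of_nonneg_left h4 (by norm_num) h3
    _ = 2 * (n : ℝ) ^ (-(1 : ℝ) / 4) := by ring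

/-- `n^{-1/20} ≤ 20 / log n` (`n ≥ 2`). [folklore] -/
private theorem rpow_neg_twentieth_le' {n : ℕ} (hn : 2 ≤ n) :
    (n : ℝ) ^ (-((1 : ℝ) / 20)) ≤ 20 / Real.log n := by
  have hn0 : (0 : ℝ) < n := by exact_mod_cast (show 0 < n by omega)
  have hlogn : 0 < Real.log n := Real.log_pos (by exact_mod_cast (show 1 < n by omega))
  have h := Real.log_le_rpow_div hn0.le (by norm_num : (0 : ℝ) < 1 / 20)
  have hp : 0 < (n : ℝ) ^ ((1 : ℝ) / 20) := Real.rpow_pos_of_pos hn0 _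
  rw [Real.rpow_neg hn0.le, inv_eq_one_div, div_le_div_iff₀ hp hlogn]
  have : Real.log n ≤ 20 * (n : ℝ) ^ ((1 : ℝ) / 20) := by
    have h' : (n : ℝ) ^ ((1 : ℝ) / 20) / (1 / 20) = 20 * (n : ℝ) ^ ((1 : ℝ) / 20) := by ring
    linarith [h'.symm ▸ h]
  linarith

/-- The Kesten tail `ε_T = 1 - Σ_{s ≤ T} λ_s μ^{-s}` is `≤ 20/log n` when `T ≥ n^{1/5}/4 ≥ μ` and
`n ≥ (4μ)^{10}`. [cite: MadrasSlade1993, eq. (4.2.4) (quantitative tail, derived)] -/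
private theorem kestenTail_le_twenty_div_log (d : ℕ) {n T : ℕ} (hn : 2 ≤ n) (hT1 : 1 ≤ T)
    (hμT : connectiveConstant (d + 2) ≤ T)
    (hTy : (n : ℝ) ^ ((1 : ℝ) / 5) / 4 ≤ T)
    (hlog : 10 * Real.log (4 * connectiveConstant (d + 2)) ≤ Real.log n) :
    1 - ∑ s ∈ Icc 1 T, (irreducibleBridgeCount (d + 2) s : ℝ) / connectiveConstant (d + 2) ^ s ≤
      20 / Real.log n := by
  set μ := connectiveConstant (d + 2) with hμdef
  have hμ : 0 < μ := connectiveConstant_pos (d + 2)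
  have hn0 : (0 : ℝ) < n := by exact_mod_cast (show 0 < n by omega)
  have hlogn : 0 < Real.log n := Real.log_pos (by exact_mod_cast (show 1 < n by omega))
  have hkt := kestenTail_le (d + 2) hT1 hμT
  refine hkt.trans ?_
  set y : ℝ := (n : ℝ) ^ ((1 : ℝ) / 5) with hydef
  have hy0 : 0 < y := Real.rpow_pos_of_pos hn0 _
  have hT0 : (0 : ℝ) < T := by exact_mod_cast (show 0 < T by omega)
  have hlogT : Real.log n / 10 ≤ Real.log ((T : ℝ) / μ) := by
    have h1' : y / (4 * μ) ≤ (T : ℝ) / μ := by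
      rw [div_le_div_iff₀ (by positivity) hμ]
      have : y * μ ≤ 4 * (T : ℝ) * μ := by nlinarith
      linarith
    have h2' := Real.log_le_log (by positivity) h1'
    rw [Real.log_div hy0.ne' (by positivity), hydef, Real.log_rpow hn0] at h2'
    linarith
  have hL0 : 0 < Real.log ((T : ℝ) / μ) := lt_of_lt_of_le (by positivity) hlogT
  calc 1 / (1 + Real.log ((T : ℝ) / μ) / 2) ≤ 1 / (Real.log ((T : ℝ) / μ) / 2) :=
        one_div_le_one_div_of_le (by positivity) (by linarith)
    _ ≤ 1 / (Real.log n / 20) := one_div_le_one_div_of_le (by positivity) (by linarith)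
    _ = 20 / Real.log n := by rw [one_div_div]

/-- The tail of the cylinder series beyond the truncation `J = m + T` ((8.3.6), (8.3.8), (8.3.11)):
`0 ≤ P^B_m(ω) - Σ_{k=m}^{m+T} |E_k(ω)| μ^{-k} ≤ 2 ε_T` (`μ ≥ 2`).
[cite: MadrasSlade1993, Theorem 8.3.1 (proof, eqs. (8.3.8), (8.3.11); quantitative form)] -/
private theorem kestenCyl_sub_partial (d : ℕ) {m : ℕ} (hm : 1 ≤ m) {ω : ℕ → Site (d + 2)}
    (hω : ω ∈ saws (d + 2) m) (T : ℕ) :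
    0 ≤ kestenCyl (d + 2) m ω -
        ∑ k ∈ Icc m (m + T), (eCount (d + 2) k m ω : ℝ) / connectiveConstant (d + 2) ^ k ∧
    kestenCyl (d + 2) m ω -
        ∑ k ∈ Icc m (m + T), (eCount (d + 2) k m ω : ℝ) / connectiveConstant (d + 2) ^ k ≤
      2 * (1 - ∑ s ∈ Icc 1 T, (irreducibleBridgeCount (d + 2) s : ℝ) / connectiveConstant (d + 2) ^ s) := by
  set μ := connectiveConstant (d + 2) with hμdef
  have hμ2 : 2 ≤ μ := by
    have h := natCast_le_connectiveConstant (d + 2)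
    have : (2 : ℝ) ≤ ((d + 2 : ℕ) : ℝ) := by exact_mod_cast (show 2 ≤ d + 2 by omega)
    exact this.trans h
  have hμ : 0 < μ := by linarith
  set e : ℕ → ℝ := fun k => (eCount (d + 2) k m ω : ℝ) with hedef
  set lam : ℕ → ℝ := fun k => (irreducibleBridgeCount (d + 2) k : ℝ) with hlamdef
  set Pm : ℝ := kestenCyl (d + 2) m ω with hPm
  set Sinf : ℝ := ∑ k ∈ Icc m (m + T), e k / μ ^ k with hSinfdef
  obtain ⟨M, hMdef⟩ : ∃ M : ℕ, M = m + T + 1 := ⟨_, rfl⟩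
  have he0 : ∀ k, 0 ≤ e k := fun k => by simp only [hedef]; positivity
  have hlam0' : ∀ j, 0 ≤ lam j := fun j => by simp only [hlamdef]; positivity
  have hlam00 : lam 0 = 0 := by simp [hlamdef]
  have h838 : ∀ k, m ≤ k → e k ≤ ∑ i ∈ Finset.range (m + 1), lam (k - i) := by
    intro k hk
    have h := eCount_le_sum_irreducibleBridgeCount k m hm hk ω
    have h' : (eCount (d + 2) k m ω : ℝ) ≤
        ∑ i ∈ Finset.range m, (irreducibleBridgeCount (d + 2) (k - i) : ℝ) := by exact_mod_cast h
    simp only [hedef, hlamdef]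
    refine h'.trans ?_
    rw [Finset.sum_range_succ]
    have : (0 : ℝ) ≤ (irreducibleBridgeCount (d + 2) (k - m) : ℝ) := by positivity
    linarith
  have hHS : HasSum (fun k => e k / μ ^ k) Pm := hasSum_kestenCyl hm hω
  have hpart : ∑ k ∈ Finset.range M, e k / μ ^ k = Sinf := by
    rw [hMdef, Finset.range_eq_Ico,
      ← Finset.sum_Ico_consecutive _ (Nat.zero_le m) (by omega : m ≤ m + T + 1),
      hSinfdef, SAW.MS831.Icc_eq_Ico_succ]
    have hz : ∑ k ∈ Ico 0 m, e k / μ ^ k = 0 :=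
      Finset.sum_eq_zero fun k hk => by
        simp only [mem_Ico] at hk
        simp only [hedef]
        rw [eCount_eq_zero_of_lt hω hk.2]; simp
    rw [hz, zero_add]
  have htailHS : HasSum (fun k => e (k + M) / μ ^ (k + M)) (Pm - Sinf) := by
    have := (hasSum_nat_add_iff' (f := fun k => e k / μ ^ k) M).2 hHS
    rw [hpart] at this
    exact this
  have htail0 : 0 ≤ Pm - Sinf :=
    htailHS.nonneg fun k => by have := he0 (k + M); positivity
  refine ⟨htail0, ?_⟩
  -- Kesten's law and its shifted tails
  have hp : HasSum (fun s => lam s / μ ^ s) 1 := by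
    simp only [hlamdef]; exact MadrasSlade1993_eq424_holds (d + 2)
  set εT : ℝ := 1 - ∑ s ∈ Icc 1 T, lam s / μ ^ s with hεTdef
  have hrange_Icc : ∑ s ∈ Finset.range (T + 1), lam s / μ ^ s = ∑ s ∈ Icc 1 T, lam s / μ ^ s := by
    rw [Finset.range_eq_Ico, ← Finset.sum_Ico_consecutive _ (Nat.zero_le 1) (by omega : 1 ≤ T + 1),
      Finset.sum_Ico_eq_sum_range, show 1 - 0 = 1 by rfl, Finset.sum_range_one, SAW.MS831.Icc_eq_Ico_succ]
    simp [hlam00]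
  have hεT0 : 0 ≤ εT := by
    have := sum_irreducibleBridgeCount_div_pow_le_one (d + 2) (Icc 1 T)
    simp only [hεTdef, hlamdef]; linarith
  set g : ℕ → ℕ → ℝ := fun i k => (μ ^ i)⁻¹ * (lam (k + (M - i)) / μ ^ (k + (M - i))) with hgdef
  have hg : ∀ i ∈ Finset.range (m + 1),
      HasSum (g i) ((μ ^ i)⁻¹ * (1 - ∑ s ∈ Finset.range (M - i), lam s / μ ^ s)) := by
    intro i _
    exact ((hasSum_nat_add_iff' (M - i)).2 hp).mul_left _
  have hG := hasSum_sum hg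
  have hle : ∀ k, e (k + M) / μ ^ (k + M) ≤ ∑ i ∈ Finset.range (m + 1), g i k := by
    intro k
    have hk := h838 (k + M) (by omega)
    have hμk : 0 < μ ^ (k + M) := pow_pos hμ _
    calc e (k + M) / μ ^ (k + M) ≤ (∑ i ∈ Finset.range (m + 1), lam (k + M - i)) / μ ^ (k + M) :=
          div_le_div_of_nonneg_right hk hμk.le
      _ = ∑ i ∈ Finset.range (m + 1), g i k := by
          rw [Finset.sum_div]
          refine Finset.sum_congr rfl fun i hi => ?_
          have him : i ≤ m := Nat.lt_succ_iff.1 (Finset.mem_range.1 hi)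
          simp only [hgdef]
          have hsplit : μ ^ (k + M) = μ ^ i * μ ^ (k + (M - i)) := by
            rw [← pow_add]; congr 1; omega
          have hμi : μ ^ i ≠ 0 := pow_ne_zero i hμ.ne'
          have hμr : μ ^ (k + (M - i)) ≠ 0 := pow_ne_zero _ hμ.ne'
          rw [show k + M - i = k + (M - i) by omega, hsplit]
          field_simp
  have h1 : Pm - Sinf ≤
      ∑ i ∈ Finset.range (m + 1), (μ ^ i)⁻¹ * (1 - ∑ s ∈ Finset.range (M - i), lam s / μ ^ s) :=
    hasSum_le hle htailHS hG
  have h2 : ∑ i ∈ Finset.range (m + 1), (μ ^ i)⁻¹ * (1 - ∑ s ∈ Finset.range (M - i), lam s / μ ^ s) ≤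
      ∑ i ∈ Finset.range (m + 1), (μ ^ i)⁻¹ * εT := by
    refine Finset.sum_le_sum fun i hi => ?_
    have him : i ≤ m := Nat.lt_succ_iff.1 (Finset.mem_range.1 hi)
    refine mul_le_mul_of_nonneg_left ?_ (by positivity)
    rw [hεTdef, ← hrange_Icc]
    have hsub : Finset.range (T + 1) ⊆ Finset.range (M - i) := Finset.range_subset_range.2 (by omega)
    have := Finset.sum_le_sum_of_subset_of_nonneg hsub fun s _ _ => show 0 ≤ lam s / μ ^ s by
      have := hlam0' s; positivity
    linarith
  have h3 : ∑ i ∈ Finset.range (m + 1), (μ ^ i)⁻¹ * εT ≤ 2 * εT := by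
    rw [← Finset.sum_mul]
    exact mul_le_mul_of_nonneg_right (sum_inv_pow_le_two hμ2 m) hεT0
  have := h1.trans (h2.trans h3)
  simpa only [hεTdef] using this

/-- The truncated head ((8.3.7)): if `|μ^k b_{n-k}/b_n - 1| ≤ Θ` for `k ≤ m + T`, then
`|Σ_{k=m}^{m+T} |E_k| b_{n-k}/b_n - Σ_{k=m}^{m+T} |E_k| μ^{-k}| ≤ (Σ_{k=m}^{m+T} |E_k| μ^{-k}) · Θ`.
[cite: MadrasSlade1993, Theorem 8.3.1 (proof, eq. (8.3.7); quantitative form)] -/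
private theorem head_bound (d : ℕ) {m T n : ℕ} {ω : ℕ → Site (d + 2)} {Θ : ℝ}
    (hq : ∀ k, k ≤ m + T →
      |connectiveConstant (d + 2) ^ k * (bridgeCount (d + 2) (n - k) : ℝ) / bridgeCount (d + 2) n - 1| ≤ Θ) :
    |(∑ k ∈ Icc m (m + T), (eCount (d + 2) k m ω : ℝ) * bridgeCount (d + 2) (n - k)) / bridgeCount (d + 2) n -
        ∑ k ∈ Icc m (m + T), (eCount (d + 2) k m ω : ℝ) / connectiveConstant (d + 2) ^ k| ≤
      (∑ k ∈ Icc m (m + T), (eCount (d + 2) k m ω : ℝ) / connectiveConstant (d + 2) ^ k) * Θ := by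
  set μ := connectiveConstant (d + 2) with hμdef
  have hμ : 0 < μ := connectiveConstant_pos (d + 2)
  have hb : ∀ k, (0 : ℝ) < bridgeCount (d + 2) k := fun k => by
    exact_mod_cast one_le_bridgeCount (d := d + 2) k
  set e : ℕ → ℝ := fun k => (eCount (d + 2) k m ω : ℝ) with hedef
  have he0 : ∀ k, 0 ≤ e k := fun k => by simp only [hedef]; positivity
  have hS' : (∑ k ∈ Icc m (m + T), e k * bridgeCount (d + 2) (n - k)) / bridgeCount (d + 2) n -
      ∑ k ∈ Icc m (m + T), e k / μ ^ k =
      ∑ k ∈ Icc m (m + T), e k / μ ^ k * (μ ^ k * (bridgeCount (d + 2) (n - k) : ℝ) / bridgeCount (d + 2) n - 1) := by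
    rw [Finset.sum_div, ← Finset.sum_sub_distrib]
    refine Finset.sum_congr rfl fun k _ => ?_
    have hbn : (bridgeCount (d + 2) n : ℝ) ≠ 0 := (hb n).ne'
    have hμk : μ ^ k ≠ 0 := pow_ne_zero k hμ.ne'
    field_simp
  rw [hS']
  calc |∑ k ∈ Icc m (m + T), e k / μ ^ k * (μ ^ k * (bridgeCount (d + 2) (n - k) : ℝ) / bridgeCount (d + 2) n - 1)|
      ≤ ∑ k ∈ Icc m (m + T), |e k / μ ^ k * (μ ^ k * (bridgeCount (d + 2) (n - k) : ℝ) / bridgeCount (d + 2) n - 1)| :=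
        Finset.abs_sum_le_sum_abs _ _
    _ ≤ ∑ k ∈ Icc m (m + T), e k / μ ^ k * Θ := by
        refine Finset.sum_le_sum fun k hk => ?_
        have hkJ : k ≤ m + T := (Finset.mem_Icc.1 hk).2
        have hek : 0 ≤ e k / μ ^ k := by have := he0 k; positivity
        rw [abs_mul, abs_of_nonneg hek]
        exact mul_le_mul_of_nonneg_left (hq k hkJ) hek
    _ = (∑ k ∈ Icc m (m + T), e k / μ ^ k) * Θ := by rw [Finset.sum_mul]

/-- One term of the remainder in (8.3.9), quantified ((8.3.10)–(8.3.13)): for `i ≤ m` and `n' = n - i`,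
`(b_{n'} - Σ_{r ≤ T} λ_r b_{n'-r})/b_n = (b_{n'}/b_n) · Σ_{T < r ≤ n'} P_{n'}(r) ≤ μ^{-i} · 2 (ε_T + Θ)`, using the
head/tail control of the first-break-point law at length `n'` and the ratio bound `b_{n-i}/b_n ≤ (3/2) μ^{-i}`.
[cite: MadrasSlade1993, Theorem 8.3.1 (proof, eqs. (8.3.9)–(8.3.13); quantitative form)] -/
private theorem remainder_term_bound (d : ℕ) {K₀ : ℝ} (hK₀ : 0 ≤ K₀) {N₀ : ℕ}
    (hL : ∀ n : ℕ, N₀ ≤ n → ∀ k : ℕ, k ^ 5 ≤ n →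
      |connectiveConstant (d + 2) ^ k * (bridgeCount (d + 2) (n - k) : ℝ) / bridgeCount (d + 2) n - 1| ≤
        K₀ * ((k : ℝ) * (n : ℝ) ^ (-(1 : ℝ) / 4) + 1 / Real.log n))
    {n i T : ℕ} (hn : 2 ≤ n) (hin : 2 * i + 4 ≤ n) (hN₀ : N₀ ≤ n - i) (hT5 : T ^ 5 ≤ n - i)
    (hTi : T ≤ n - i) (hTy : (T : ℝ) ≤ (n : ℝ) ^ ((1 : ℝ) / 5))
    {Θ : ℝ} (hΘ : K₀ * (2 * (n : ℝ) ^ (-((1 : ℝ) / 20)) + 2 / Real.log n) ≤ Θ) (hΘhalf : Θ ≤ 1 / 2)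
    (hqi : |connectiveConstant (d + 2) ^ i * (bridgeCount (d + 2) (n - i) : ℝ) / bridgeCount (d + 2) n - 1| ≤ Θ) :
    ((bridgeCount (d + 2) (n - i) : ℝ) -
        ∑ r ∈ Finset.range (T + 1), (irreducibleBridgeCount (d + 2) r : ℝ) * bridgeCount (d + 2) (n - i - r)) /
        bridgeCount (d + 2) n ≤
      (connectiveConstant (d + 2) ^ i)⁻¹ *
        (2 * ((1 - ∑ s ∈ Icc 1 T, (irreducibleBridgeCount (d + 2) s : ℝ) / connectiveConstant (d + 2) ^ s) + Θ)) := by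
  set μ := connectiveConstant (d + 2) with hμdef
  have hμ : 0 < μ := connectiveConstant_pos (d + 2)
  have hb : ∀ k, (0 : ℝ) < bridgeCount (d + 2) k := fun k => by
    exact_mod_cast one_le_bridgeCount (d := d + 2) k
  have hn0 : (0 : ℝ) < n := by exact_mod_cast (show 0 < n by omega)
  have hlogn : 0 < Real.log n := Real.log_pos (by exact_mod_cast (show 1 < n by omega))
  set n' : ℕ := n - i with hn'def
  have hn'1 : 1 ≤ n' := by omega
  have hn'2 : 2 ≤ n' := by omega
  have hnn' : n ≤ 2 * n' := by omega
  have hn'0 : (0 : ℝ) < n' := by exact_mod_cast (show 0 < n' by omega)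
  set εT : ℝ := 1 - ∑ s ∈ Icc 1 T, (irreducibleBridgeCount (d + 2) s : ℝ) / μ ^ s with hεTdef
  -- numerator = b_{n'} · (tail of the first-break law at n')
  have hnum := sub_sum_eq_mul_tail (d := d + 2) hn'1 hTi
  -- the tail bound at `n'`
  have hL' : ∀ k : ℕ, k ^ 5 ≤ n' →
      |μ ^ k * (bridgeCount (d + 2) (n' - k) : ℝ) / bridgeCount (d + 2) n' - 1| ≤
        K₀ * ((k : ℝ) * (n' : ℝ) ^ (-(1 : ℝ) / 4) + 1 / Real.log n') :=
    fun k hk => hL n' hN₀ k hk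
  have hft := (firstBreakLaw_head_tail (d := d) hK₀ hn'2 hL' hT5).2
  -- `K₀ (T n'^{-1/4} + 1/log n') ≤ Θ`
  have hpow : (n' : ℝ) ^ (-(1 : ℝ) / 4) ≤ 2 * (n : ℝ) ^ (-(1 : ℝ) / 4) :=
    rpow_neg_quarter_le_two_mul (by omega) hn'1 hnn'
  have hlog' : 1 / Real.log n' ≤ 2 / Real.log n := by
    have hsq : (n : ℝ) ≤ (n' : ℝ) ^ 2 := by
      have : n ≤ n' * n' := by nlinarith
      have : (n : ℝ) ≤ (n' : ℝ) * n' := by exact_mod_cast this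
      nlinarith
    have hl : Real.log n ≤ 2 * Real.log n' := by
      have := Real.log_le_log hn0 hsq
      rwa [Real.log_pow, Nat.cast_ofNat] at this
    have hlogn' : 0 < Real.log n' := Real.log_pos (by exact_mod_cast (show 1 < n' by omega))
    rw [div_le_div_iff₀ hlogn' hlogn]
    linarith
  have hyr : (n : ℝ) ^ ((1 : ℝ) / 5) * (n : ℝ) ^ (-(1 : ℝ) / 4) = (n : ℝ) ^ (-((1 : ℝ) / 20)) := by
    rw [← Real.rpow_add hn0]; norm_num
  have hr4 : 0 ≤ (n : ℝ) ^ (-(1 : ℝ) / 4) := Real.rpow_nonneg hn0.le _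
  have hy0 : 0 ≤ (n : ℝ) ^ ((1 : ℝ) / 5) := Real.rpow_nonneg hn0.le _
  have hK' : K₀ * ((T : ℝ) * (n' : ℝ) ^ (-(1 : ℝ) / 4) + 1 / Real.log n') ≤ Θ := by
    refine le_trans (mul_le_mul_of_nonneg_left ?_ hK₀) hΘ
    have h1 : (T : ℝ) * (n' : ℝ) ^ (-(1 : ℝ) / 4) ≤ (n : ℝ) ^ ((1 : ℝ) / 5) * (2 * (n : ℝ) ^ (-(1 : ℝ) / 4)) :=
      mul_le_mul hTy hpow (Real.rpow_nonneg hn'0.le _) hy0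
    have h2 : (n : ℝ) ^ ((1 : ℝ) / 5) * (2 * (n : ℝ) ^ (-(1 : ℝ) / 4)) = 2 * (n : ℝ) ^ (-((1 : ℝ) / 20)) := by
      rw [← hyr]; ring
    linarith
  have htailP : ∑ r ∈ Ico (T + 1) (n' + 1),
      (irreducibleBridgeCount (d + 2) r : ℝ) * (bridgeCount (d + 2) (n' - r) : ℝ) / bridgeCount (d + 2) n' ≤ εT + Θ := by
    refine hft.trans ?_
    rw [hεTdef]
    linarith
  have htailP0 : 0 ≤ ∑ r ∈ Ico (T + 1) (n' + 1),
      (irreducibleBridgeCount (d + 2) r : ℝ) * (bridgeCount (d + 2) (n' - r) : ℝ) / bridgeCount (d + 2) n' :=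
    Finset.sum_nonneg fun r _ => by
      have := hb (n' - r); have := hb n'; positivity
  -- `b_{n'}/b_n ≤ 2 μ^{-i}`
  have hratio : (bridgeCount (d + 2) n' : ℝ) / bridgeCount (d + 2) n ≤ 2 * (μ ^ i)⁻¹ := by
    have hx : μ ^ i * (bridgeCount (d + 2) (n - i) : ℝ) / bridgeCount (d + 2) n ≤ 3 / 2 := by
      have := (abs_le.1 hqi).2; linarith
    have hμi : 0 < μ ^ i := pow_pos hμ i
    have hid : (bridgeCount (d + 2) n' : ℝ) / bridgeCount (d + 2) n =
        (μ ^ i)⁻¹ * (μ ^ i * (bridgeCount (d + 2) (n - i) : ℝ) / bridgeCount (d + 2) n) := by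
      rw [hn'def]; field_simp
    rw [hid]
    have : (μ ^ i)⁻¹ * (μ ^ i * (bridgeCount (d + 2) (n - i) : ℝ) / bridgeCount (d + 2) n) ≤ (μ ^ i)⁻¹ * (3 / 2) :=
      mul_le_mul_of_nonneg_left hx (by positivity)
    have h0 : 0 ≤ (μ ^ i)⁻¹ := by positivity
    linarith
  have hnum' : ((bridgeCount (d + 2) (n - i) : ℝ) -
      ∑ r ∈ Finset.range (T + 1), (irreducibleBridgeCount (d + 2) r : ℝ) * bridgeCount (d + 2) (n - i - r)) /
      bridgeCount (d + 2) n =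
      (bridgeCount (d + 2) n' : ℝ) / bridgeCount (d + 2) n *
        ∑ r ∈ Ico (T + 1) (n' + 1),
          (irreducibleBridgeCount (d + 2) r : ℝ) * (bridgeCount (d + 2) (n' - r) : ℝ) / bridgeCount (d + 2) n' := by
    rw [← hn'def, hnum, mul_div_right_comm]
  rw [hnum']
  calc (bridgeCount (d + 2) n' : ℝ) / bridgeCount (d + 2) n *
        ∑ r ∈ Ico (T + 1) (n' + 1),
          (irreducibleBridgeCount (d + 2) r : ℝ) * (bridgeCount (d + 2) (n' - r) : ℝ) / bridgeCount (d + 2) n'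
      ≤ 2 * (μ ^ i)⁻¹ * (εT + Θ) := mul_le_mul hratio htailP htailP0 (by positivity)
    _ = (μ ^ i)⁻¹ * (2 * (εT + Θ)) := by ring

/-- The regime estimate of the quantitative Theorem 8.3.1: for `m ≥ 1`, `2(m+1) ≤ ⌊n^{1/5}⌋` and `n`
beyond the thresholds, `|P^B_{m,n}(ω) - P^B_m(ω)| ≤ (210 K₀ + 80)/log n`.
[cite: MadrasSlade1993, Theorem 8.3.1 (proof; quantitative form, derived)] -/
private theorem regime_bound (d : ℕ) {K₀ : ℝ} (hK₀ : 0 ≤ K₀) {N₀ : ℕ}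
    (hL : ∀ n : ℕ, N₀ ≤ n → ∀ k : ℕ, k ^ 5 ≤ n →
      |connectiveConstant (d + 2) ^ k * (bridgeCount (d + 2) (n - k) : ℝ) / bridgeCount (d + 2) n - 1| ≤
        K₀ * ((k : ℝ) * (n : ℝ) ^ (-(1 : ℝ) / 4) + 1 / Real.log n))
    {m n : ℕ} (hm : 1 ≤ m) (hmn : m ≤ n) (hn : 2 ≤ n) {ω : ℕ → Site (d + 2)} (hω : ω ∈ saws (d + 2) m)
    (h1 : 2 * N₀ + 4 ≤ n) (h2 : 10 * Real.log (4 * connectiveConstant (d + 2)) ≤ Real.log n)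
    (h3 : 4 * connectiveConstant (d + 2) ≤ (n : ℝ) ^ ((1 : ℝ) / 5))
    (h4 : K₀ * (2 * (n : ℝ) ^ (-((1 : ℝ) / 20)) + 2 / Real.log n) ≤ 1 / 2)
    (hmJ : 2 * (m + 1) ≤ ⌊(n : ℝ) ^ ((1 : ℝ) / 5)⌋₊) :
    |(bridgeExtCount (d + 2) n m ω : ℝ) / bridgeCount (d + 2) n - kestenCyl (d + 2) m ω| ≤
      (210 * K₀ + 80) / Real.log n := by
  set μ := connectiveConstant (d + 2) with hμdef
  have hμ2 : 2 ≤ μ := by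
    have h := natCast_le_connectiveConstant (d + 2)
    have : (2 : ℝ) ≤ ((d + 2 : ℕ) : ℝ) := by exact_mod_cast (show 2 ≤ d + 2 by omega)
    exact this.trans h
  have hμ : 0 < μ := by linarith
  have hb : ∀ k, (0 : ℝ) < bridgeCount (d + 2) k := fun k => by
    exact_mod_cast one_le_bridgeCount (d := d + 2) k
  have hn0 : (0 : ℝ) < n := by exact_mod_cast (show 0 < n by omega)
  have hlogn : 0 < Real.log n := Real.log_pos (by exact_mod_cast (show 1 < n by omega))
  set Pmn : ℝ := (bridgeExtCount (d + 2) n m ω : ℝ) / bridgeCount (d + 2) n with hPmn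
  set Pm : ℝ := kestenCyl (d + 2) m ω with hPm
  have hPm01 : Pm ∈ Set.Icc (0 : ℝ) 1 := kestenCyl_mem_Icc hm hω
  set J : ℕ := ⌊(n : ℝ) ^ ((1 : ℝ) / 5)⌋₊ with hJdef
  set y : ℝ := (n : ℝ) ^ ((1 : ℝ) / 5) with hydef
  have hy2 : 2 ≤ y := by linarith
  have hy0 : 0 < y := by linarith
  have hy5 : y ^ 5 = n := by
    rw [hydef, show ((1 : ℝ) / 5) = ((5 : ℕ) : ℝ)⁻¹ by norm_num]
    exact Real.rpow_inv_natCast_pow hn0.le (by norm_num)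
  have hJy : (J : ℝ) ≤ y := Nat.floor_le hy0.le
  have hJ5 : J ^ 5 ≤ n := by
    have : (J : ℝ) ^ 5 ≤ y ^ 5 := pow_le_pow_left₀ (Nat.cast_nonneg J) hJy 5
    rw [hy5] at this; exact_mod_cast this
  have h16J : 16 * J ≤ n := by
    have hy16 : 16 * y ≤ y ^ 5 := by
      have h16 : (2 : ℝ) ^ 4 ≤ y ^ 4 := pow_le_pow_left₀ (by norm_num) hy2 4
      nlinarith
    have : 16 * (J : ℝ) ≤ n := by rw [← hy5]; linarith
    exact_mod_cast this
  -- `T = J - m`, so `J = m + T`, `T ≥ J/2 ≥ y/4 ≥ μ`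
  set T : ℕ := J - m with hTdef
  have hJmT : m + T = J := by omega
  have hT1 : 1 ≤ T := by omega
  have hTJ : (J : ℝ) ≤ 2 * T := by exact_mod_cast (show J ≤ 2 * T by omega)
  have hyJ : y < J + 1 := Nat.lt_floor_add_one y
  have hTy : y / 4 ≤ T := by linarith
  have hμT : μ ≤ T := by linarith
  have hTJle : T ≤ J := by omega
  have hT5J : T ^ 5 + J ≤ J ^ 5 := by
    obtain ⟨a, ha⟩ : ∃ a, J = a + 1 := ⟨J - 1, by omega⟩
    have hTa : T ≤ a := by omega
    have h1' : T ^ 5 ≤ a ^ 5 := Nat.pow_le_pow_left hTa 5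
    have h2' : (a + 1) ^ 5 = a ^ 5 + a + 1 + (5 * a ^ 4 + 10 * a ^ 3 + 10 * a ^ 2 + 4 * a) := by ring
    rw [ha, h2']; omega
  -- the scale `Θ`
  set Θ : ℝ := K₀ * (2 * (n : ℝ) ^ (-((1 : ℝ) / 20)) + 2 / Real.log n) with hΘdef
  have hΘhalf : Θ ≤ 1 / 2 := h4
  have hr20 : 0 ≤ (n : ℝ) ^ (-((1 : ℝ) / 20)) := Real.rpow_nonneg hn0.le _
  have hr4 : 0 ≤ (n : ℝ) ^ (-(1 : ℝ) / 4) := Real.rpow_nonneg hn0.le _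
  have hΘ0 : 0 ≤ Θ := by positivity
  have hyr : y * (n : ℝ) ^ (-(1 : ℝ) / 4) = (n : ℝ) ^ (-((1 : ℝ) / 20)) := by
    rw [hydef, ← Real.rpow_add hn0]; norm_num
  -- the uniform ratio bound on `k ≤ J`
  have hq : ∀ k, k ≤ J →
      |μ ^ k * (bridgeCount (d + 2) (n - k) : ℝ) / bridgeCount (d + 2) n - 1| ≤ Θ := by
    intro k hk
    have hk5 : k ^ 5 ≤ n := le_trans (Nat.pow_le_pow_left hk 5) hJ5
    refine (hL n (by omega) k hk5).trans ?_
    rw [hΘdef]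
    refine mul_le_mul_of_nonneg_left ?_ hK₀
    have hky : (k : ℝ) ≤ y := le_trans (by exact_mod_cast hk) hJy
    have hkr : (k : ℝ) * (n : ℝ) ^ (-(1 : ℝ) / 4) ≤ (n : ℝ) ^ (-((1 : ℝ) / 20)) := by
      rw [← hyr]; exact mul_le_mul_of_nonneg_right hky hr4
    have hl0 : 0 ≤ 1 / Real.log n := by positivity
    have hA : (k : ℝ) * (n : ℝ) ^ (-(1 : ℝ) / 4) + 1 / Real.log n ≤
        (n : ℝ) ^ (-((1 : ℝ) / 20)) + 1 / Real.log n := add_le_add hkr le_rfl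
    have hB : (n : ℝ) ^ (-((1 : ℝ) / 20)) + 1 / Real.log n ≤
        2 * (n : ℝ) ^ (-((1 : ℝ) / 20)) + 2 / Real.log n := by
      have : 2 / Real.log n = 2 * (1 / Real.log n) := by ring
      rw [this]; linarith
    exact hA.trans hB
  -- ===== (8.3.5) and the truncation =====
  set e : ℕ → ℝ := fun k => (eCount (d + 2) k m ω : ℝ) with hedef
  set bb : ℕ → ℝ := fun k => (bridgeCount (d + 2) k : ℝ) with hbbdef
  set lam : ℕ → ℝ := fun k => (irreducibleBridgeCount (d + 2) k : ℝ) with hlamdef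
  have he0 : ∀ k, 0 ≤ e k := fun k => by simp only [hedef]; positivity
  have hbb : ∀ k, 0 < bb k := fun k => hb k
  have hlam0' : ∀ j, 0 ≤ lam j := fun j => by simp only [hlamdef]; positivity
  have hlam00 : lam 0 = 0 := by simp [hlamdef]
  have hren : ∀ n', 1 ≤ n' → bb n' = ∑ s ∈ Icc 1 n', lam s * bb (n' - s) := fun n' hn' => by
    simp only [hbbdef, hlamdef]; exact bridgeCount_eq_sum_Icc_real (d := d + 2) hn'
  have h838 : ∀ k, m ≤ k → e k ≤ ∑ i ∈ Finset.range (m + 1), lam (k - i) := by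
    intro k hk
    have h := eCount_le_sum_irreducibleBridgeCount k m hm hk ω
    have h' : (eCount (d + 2) k m ω : ℝ) ≤
        ∑ i ∈ Finset.range m, (irreducibleBridgeCount (d + 2) (k - i) : ℝ) := by exact_mod_cast h
    simp only [hedef, hlamdef]
    refine h'.trans ?_
    rw [Finset.sum_range_succ]
    have : (0 : ℝ) ≤ (irreducibleBridgeCount (d + 2) (k - m) : ℝ) := by positivity
    linarith
  have h835 : (bridgeExtCount (d + 2) n m ω : ℝ) = ∑ k ∈ Icc m n, e k * bb (n - k) := by
    have := bridgeExtCount_eq_sum_eCount n m hmn ω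
    simp only [hedef, hbbdef]
    exact_mod_cast this
  set S : ℝ := ∑ k ∈ Icc m (m + T), e k * bb (n - k) with hSdef
  set R : ℝ := ∑ i ∈ Finset.range (m + 1),
    (bb (n - i) - ∑ r ∈ Finset.range (T + 1), lam r * bb (n - i - r)) with hRdef
  have hmTn : m + T + 1 ≤ n := by omega
  have hlow : S ≤ ∑ k ∈ Icc m n, e k * bb (n - k) := SAW.MS831.sum_trunc_le hbb he0 (by omega)
  have hupp : ∑ k ∈ Icc m n, e k * bb (n - k) ≤ S + R :=
    SAW.MS831.sum_tail_le hbb hlam0' hlam00 hren h838 hmTn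
  -- the series side
  set Sinf : ℝ := ∑ k ∈ Icc m (m + T), e k / μ ^ k with hSinfdef
  set εT : ℝ := 1 - ∑ s ∈ Icc 1 T, lam s / μ ^ s with hεTdef
  obtain ⟨htail0, htail_le⟩ := kestenCyl_sub_partial d hm hω T
  have htail0' : 0 ≤ Pm - Sinf := by simpa only [hPm, hSinfdef, hedef] using htail0
  have htail_le' : Pm - Sinf ≤ 2 * εT := by simpa only [hPm, hSinfdef, hedef, hεTdef, hlamdef] using htail_le
  have hεT_le : εT ≤ 20 / Real.log n := by
    simpa only [hεTdef, hlamdef] using kestenTail_le_twenty_div_log d hn hT1 hμT (by linarith) h2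
  -- head
  have hSinf1 : Sinf ≤ 1 := by linarith [hPm01.2]
  have hhead : |S / bb n - Sinf| ≤ Θ := by
    have h := head_bound d (m := m) (T := T) (n := n) (ω := ω) (fun k hk => hq k (by omega))
    have h' : |S / bb n - Sinf| ≤ Sinf * Θ := by simpa only [hSdef, hSinfdef, hedef, hbbdef] using h
    have hSinf0 : 0 ≤ Sinf := Finset.sum_nonneg fun k _ => by have := he0 k; positivity
    exact h'.trans ((mul_le_mul_of_nonneg_right hSinf1 hΘ0).trans (one_mul Θ).le)
  -- remainder
  have hR : R / bb n ≤ 4 * (εT + Θ) := by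
    have hterm : ∀ i ∈ Finset.range (m + 1),
        (bb (n - i) - ∑ r ∈ Finset.range (T + 1), lam r * bb (n - i - r)) / bb n ≤
          (μ ^ i)⁻¹ * (2 * (εT + Θ)) := by
      intro i hi
      have him : i ≤ m := Nat.lt_succ_iff.1 (Finset.mem_range.1 hi)
      have h := remainder_term_bound d hK₀ hL (n := n) (i := i) (T := T) hn (by omega) (by omega) (by omega) (by omega)
        (le_trans (by exact_mod_cast hTJle) hJy) (le_of_eq hΘdef.symm) hΘhalf (hq i (by omega))
      simpa only [hbbdef, hlamdef, hεTdef] using h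
    calc R / bb n = ∑ i ∈ Finset.range (m + 1),
          (bb (n - i) - ∑ r ∈ Finset.range (T + 1), lam r * bb (n - i - r)) / bb n := by
          rw [hRdef, Finset.sum_div]
      _ ≤ ∑ i ∈ Finset.range (m + 1), (μ ^ i)⁻¹ * (2 * (εT + Θ)) := Finset.sum_le_sum hterm
      _ = (∑ i ∈ Finset.range (m + 1), (μ ^ i)⁻¹) * (2 * (εT + Θ)) := by rw [Finset.sum_mul]
      _ ≤ 2 * (2 * (εT + Θ)) := by
          refine mul_le_mul_of_nonneg_right (sum_inv_pow_le_two hμ2 m) ?_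
          have hεT0 : 0 ≤ εT := by
            have := sum_irreducibleBridgeCount_div_pow_le_one (d + 2) (Icc 1 T)
            simp only [hεTdef, hlamdef]; linarith
          positivity
      _ = 4 * (εT + Θ) := by ring
  -- ===== assembly =====
  have hPmn_eq : Pmn = (∑ k ∈ Icc m n, e k * bb (n - k)) / bb n := by rw [hPmn, h835]
  have hlo' : S / bb n ≤ Pmn := by
    rw [hPmn_eq]; exact div_le_div_of_nonneg_right hlow (hbb n).le
  have hup' : Pmn ≤ S / bb n + R / bb n := by
    rw [hPmn_eq, ← add_div]; exact div_le_div_of_nonneg_right hupp (hbb n).le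
  have habsS := abs_le.1 hhead
  have hD : |Pmn - Pm| ≤ 5 * Θ + 4 * εT := by
    rw [abs_le]; constructor <;> linarith
  have h20 : (n : ℝ) ^ (-((1 : ℝ) / 20)) ≤ 20 / Real.log n := rpow_neg_twentieth_le' hn
  have hΘb : Θ ≤ 42 * K₀ / Real.log n := by
    rw [hΘdef]
    calc K₀ * (2 * (n : ℝ) ^ (-((1 : ℝ) / 20)) + 2 / Real.log n)
        ≤ K₀ * (2 * (20 / Real.log n) + 2 / Real.log n) := by gcongr
      _ = 42 * K₀ / Real.log n := by ring
  refine hD.trans ?_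
  calc 5 * Θ + 4 * εT ≤ 5 * (42 * K₀ / Real.log n) + 4 * (20 / Real.log n) := by linarith
    _ = (210 * K₀ + 80) / Real.log n := by ring

/-- **Madras–Slade Theorem 8.3.1 WITH A RATE (Kesten's infinite-bridge measure as a quantitative limit),
every dimension `d + 2 ≥ 2`:** there is `K` such that for all `m ≤ n`, `n ≥ 2` and every `m`-step
self-avoiding walk `ω`, `|P^B_{m,n}(ω) - P^B_m(ω)| ≤ K · log(m+2)/log n`, where
`P^B_{m,n}(ω) = |F_n(ω) ∩ B_n|/b_n` is the fraction of `n`-step bridges extending `ω` and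
`P^B_m(ω) = Σ_k |E_k(ω)| μ^{-k}` is Kesten's cylinder weight (8.3.6). The rate is `K'/log n` uniformly in
the regime `2(m+1) ≤ n^{1/5}`; the printed theorem is the limit with no rate.
[cite: MadrasSlade1993, Theorem 8.3.1 (p. 273) (quantitative form, derived)] -/
theorem kestenCyl_rate (d : ℕ) :
    ∃ K : ℝ, ∀ m n : ℕ, m ≤ n → 2 ≤ n → ∀ ω : ℕ → Site (d + 2), ω ∈ saws (d + 2) m →
      |(bridgeExtCount (d + 2) n m ω : ℝ) / bridgeCount (d + 2) n - kestenCyl (d + 2) m ω| ≤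
        K * Real.log (m + 2) / Real.log n := by
  set μ := connectiveConstant (d + 2) with hμdef
  have hμ2 : 2 ≤ μ := by
    have h := natCast_le_connectiveConstant (d + 2)
    have : (2 : ℝ) ≤ ((d + 2 : ℕ) : ℝ) := by exact_mod_cast (show 2 ≤ d + 2 by omega)
    exact this.trans h
  have hμ : 0 < μ := by linarith
  obtain ⟨K₀, hK₀, N₀, hL⟩ := ratio_uniform d
  have hb : ∀ k, (0 : ℝ) < bridgeCount (d + 2) k := fun k => by
    exact_mod_cast one_le_bridgeCount (d := d + 2) k
  -- thresholds in `n`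
  have hev1 : ∀ᶠ n : ℕ in atTop, 2 * N₀ + 4 ≤ n := eventually_ge_atTop _
  have hev2 : ∀ᶠ n : ℕ in atTop, 10 * Real.log (4 * μ) ≤ Real.log n :=
    (Real.tendsto_log_atTop.comp tendsto_natCast_atTop_atTop).eventually_ge_atTop _
  have hev3 : ∀ᶠ n : ℕ in atTop, 4 * μ ≤ (n : ℝ) ^ ((1 : ℝ) / 5) :=
    ((tendsto_rpow_atTop (by norm_num : (0 : ℝ) < 1 / 5)).comp tendsto_natCast_atTop_atTop).eventually_ge_atTop _
  have ht0 : Tendsto (fun n : ℕ => (n : ℝ) ^ (-((1 : ℝ) / 20))) atTop (𝓝 0) :=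
    (tendsto_rpow_neg_atTop (by norm_num : (0 : ℝ) < 1 / 20)).comp tendsto_natCast_atTop_atTop
  have hlt : Tendsto (fun n : ℕ => Real.log (n : ℝ)) atTop atTop :=
    Real.tendsto_log_atTop.comp tendsto_natCast_atTop_atTop
  have htl : Tendsto (fun n : ℕ => 1 / Real.log n) atTop (𝓝 0) := by
    refine (hlt.inv_tendsto_atTop).congr fun n => ?_
    simp only [Pi.inv_apply, one_div]
  have hΘt : Tendsto (fun n : ℕ => K₀ * (2 * (n : ℝ) ^ (-((1 : ℝ) / 20)) + 2 / Real.log n)) atTop (𝓝 0) := by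
    have h1 : Tendsto (fun n : ℕ => 2 * (n : ℝ) ^ (-((1 : ℝ) / 20)) + 2 * (1 / Real.log n)) atTop (𝓝 0) := by
      simpa using (ht0.const_mul 2).add (htl.const_mul 2)
    have h2 := h1.const_mul K₀
    simp only [mul_zero] at h2
    refine h2.congr fun n => ?_
    ring
  have hev4 : ∀ᶠ n : ℕ in atTop, K₀ * (2 * (n : ℝ) ^ (-((1 : ℝ) / 20)) + 2 / Real.log n) ≤ 1 / 2 :=
    hΘt.eventually (ge_mem_nhds (by norm_num : (0 : ℝ) < 1 / 2))
  obtain ⟨N₁, hN₁⟩ := eventually_atTop.1 (((hev1.and hev2).and hev3).and hev4)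
  have hN₁2 : 2 ≤ N₁ := by
    have := (((hN₁ N₁ le_rfl).1).1).1; omega
  have hlogN₁ : 0 ≤ Real.log N₁ := Real.log_natCast_nonneg N₁
  have hlog2 : 0 < Real.log 2 := Real.log_pos (by norm_num)
  set C : ℝ := 210 * K₀ + 100 with hCdef
  have hC0 : 0 ≤ C := by positivity
  refine ⟨10 + Real.log N₁ / Real.log 2 + C / Real.log 2, fun m n hmn hn ω hω => ?_⟩
  have hn0 : (0 : ℝ) < n := by exact_mod_cast (show 0 < n by omega)
  have hlogn : 0 < Real.log n := Real.log_pos (by exact_mod_cast (show 1 < n by omega))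
  have hlogm2 : Real.log 2 ≤ Real.log ((m : ℝ) + 2) :=
    Real.log_le_log (by norm_num) (by have : (0:ℝ) ≤ m := Nat.cast_nonneg m; linarith)
  have hlogm0 : 0 < Real.log ((m : ℝ) + 2) := lt_of_lt_of_le hlog2 hlogm2
  have hA0 : 0 ≤ Real.log N₁ / Real.log 2 := by positivity
  have hB0 : 0 ≤ C / Real.log 2 := by positivity
  set Pmn : ℝ := (bridgeExtCount (d + 2) n m ω : ℝ) / bridgeCount (d + 2) n with hPmn
  set Pm : ℝ := kestenCyl (d + 2) m ω with hPm
  -- `m = 0`: both sides equal `1`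
  rcases Nat.eq_zero_or_pos m with rfl | hm
  · have h1 : Pmn = 1 := by
      rw [hPmn, bridgeExtCount_zero_left n hω, div_self (hb n).ne']
    have h2 : Pm = 1 := by rw [hPm, kestenCyl_zero_left hω]
    rw [h1, h2, sub_self, abs_zero]
    positivity
  -- `0 ≤ Pmn, Pm ≤ 1`
  have hPmn01 : Pmn ∈ Set.Icc (0 : ℝ) 1 := bridgeCylProb_mem_Icc m n ω
  have hPm01 : Pm ∈ Set.Icc (0 : ℝ) 1 := kestenCyl_mem_Icc hm hω
  have hD1 : |Pmn - Pm| ≤ 1 := by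
    rw [abs_le]; constructor <;> linarith [hPmn01.1, hPmn01.2, hPm01.1, hPm01.2]
  set J : ℕ := ⌊(n : ℝ) ^ ((1 : ℝ) / 5)⌋₊ with hJdef
  by_cases hreg : N₁ ≤ n ∧ 2 * (m + 1) ≤ J
  swap
  · -- outside the regime the claimed bound is `≥ 1`
    refine hD1.trans ?_
    rw [le_div_iff₀ hlogn, one_mul]
    rw [not_and_or] at hreg
    rcases hreg with hsmall | hbigm
    · -- `log n ≤ log N₁ ≤ (log N₁ / log 2) log(m+2)`
      have hnN : Real.log n ≤ Real.log N₁ :=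
        Real.log_le_log hn0 (by exact_mod_cast (show n ≤ N₁ by omega))
      have hA : Real.log N₁ ≤ Real.log N₁ / Real.log 2 * Real.log ((m : ℝ) + 2) := by
        rw [div_mul_eq_mul_div, le_div_iff₀ hlog2]
        exact mul_le_mul_of_nonneg_left hlogm2 hlogN₁
      have hB : 0 ≤ (10 + C / Real.log 2) * Real.log ((m : ℝ) + 2) := by positivity
      have hsplit : (10 + Real.log N₁ / Real.log 2 + C / Real.log 2) * Real.log ((m : ℝ) + 2) =
          Real.log N₁ / Real.log 2 * Real.log ((m : ℝ) + 2) + (10 + C / Real.log 2) * Real.log ((m : ℝ) + 2) := by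
        ring
      rw [hsplit]; linarith
    · -- `log n < 10 log(m+2)`
      have hylt : (n : ℝ) ^ ((1 : ℝ) / 5) < 2 * ((m : ℝ) + 2) := by
        have hf := Nat.lt_floor_add_one ((n : ℝ) ^ ((1 : ℝ) / 5))
        have hJ' : (J : ℝ) + 1 ≤ 2 * (m : ℝ) + 3 := by exact_mod_cast (show J + 1 ≤ 2 * m + 3 by omega)
        rw [← hJdef] at hf; linarith
      have hy0 : 0 < (n : ℝ) ^ ((1 : ℝ) / 5) := Real.rpow_pos_of_pos hn0 _
      have hA : Real.log n < 10 * Real.log ((m : ℝ) + 2) := by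
        have hl := Real.log_lt_log hy0 hylt
        rw [Real.log_rpow hn0, Real.log_mul (by norm_num) (by positivity)] at hl
        linarith
      have hB : 0 ≤ (Real.log N₁ / Real.log 2 + C / Real.log 2) * Real.log ((m : ℝ) + 2) := by positivity
      have hsplit : (10 + Real.log N₁ / Real.log 2 + C / Real.log 2) * Real.log ((m : ℝ) + 2) =
          10 * Real.log ((m : ℝ) + 2) + (Real.log N₁ / Real.log 2 + C / Real.log 2) * Real.log ((m : ℝ) + 2) := by
        ring
      rw [hsplit]; linarith
  -- the regime
  obtain ⟨hnN₁, hmJ⟩ := hreg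
  obtain ⟨⟨⟨h1, h2⟩, h3⟩, h4⟩ := hN₁ n hnN₁
  have hfin : |Pmn - Pm| ≤ C / Real.log n := by
    have h := regime_bound d hK₀ hL hm hmn hn hω h1 h2 h3 h4 hmJ
    exact h.trans (div_le_div_of_nonneg_right (by rw [hCdef]; linarith) hlogn.le)
  refine hfin.trans ?_
  rw [div_le_div_iff₀ hlogn hlogn]
  have hA : C ≤ C / Real.log 2 * Real.log ((m : ℝ) + 2) := by
    rw [div_mul_eq_mul_div, le_div_iff₀ hlog2]
    exact mul_le_mul_of_nonneg_left hlogm2 hC0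
  have hsplit : (10 + Real.log N₁ / Real.log 2 + C / Real.log 2) * Real.log ((m : ℝ) + 2) * Real.log n =
      (10 + Real.log N₁ / Real.log 2) * Real.log ((m : ℝ) + 2) * Real.log n +
        (C / Real.log 2 * Real.log ((m : ℝ) + 2)) * Real.log n := by ring
  rw [hsplit]
  have hC' : C * Real.log n ≤ (C / Real.log 2 * Real.log ((m : ℝ) + 2)) * Real.log n :=
    mul_le_mul_of_nonneg_right hA hlogn.le
  have hD' : 0 ≤ (10 + Real.log N₁ / Real.log 2) * Real.log ((m : ℝ) + 2) * Real.log n := by positivity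
  linarith

/-! ### The total-variation form: quantitative weak convergence to Kesten's measure -/

/-- The series tail beyond the truncation as a `HasSum`:
`Σ_{k ≥ m+T+1} |E_k(ω)| μ^{-k} = P^B_m(ω) - Σ_{k=m}^{m+T} |E_k(ω)| μ^{-k}`.
[cite: MadrasSlade1993, Theorem 8.3.1 (proof, eq. (8.3.6))] -/
private theorem hasSum_kestenCyl_tail (d : ℕ) {m : ℕ} (hm : 1 ≤ m) {ω : ℕ → Site (d + 2)}
    (hω : ω ∈ saws (d + 2) m) (T : ℕ) :
    HasSum (fun k => (eCount (d + 2) (k + (m + T + 1)) m ω : ℝ) / connectiveConstant (d + 2) ^ (k + (m + T + 1)))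
      (kestenCyl (d + 2) m ω -
        ∑ k ∈ Icc m (m + T), (eCount (d + 2) k m ω : ℝ) / connectiveConstant (d + 2) ^ k) := by
  set μ := connectiveConstant (d + 2) with hμdef
  have hHS := hasSum_kestenCyl hm hω
  have hpart : ∑ k ∈ Finset.range (m + T + 1), (eCount (d + 2) k m ω : ℝ) / μ ^ k =
      ∑ k ∈ Icc m (m + T), (eCount (d + 2) k m ω : ℝ) / μ ^ k := by
    rw [Finset.range_eq_Ico, ← Finset.sum_Ico_consecutive _ (Nat.zero_le m) (by omega : m ≤ m + T + 1),
      SAW.MS831.Icc_eq_Ico_succ]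
    have hz : ∑ k ∈ Ico 0 m, (eCount (d + 2) k m ω : ℝ) / μ ^ k = 0 :=
      Finset.sum_eq_zero fun k hk => by
        simp only [mem_Ico] at hk
        rw [eCount_eq_zero_of_lt hω hk.2]; simp
    rw [hz, zero_add]
  have := (hasSum_nat_add_iff' (f := fun k => (eCount (d + 2) k m ω : ℝ) / μ ^ k) (m + T + 1)).2 hHS
  rw [hpart] at this
  exact this

/-- The `ω`-summed series tail ((8.3.8) summed, then (B.5)-type bookkeeping):
`Σ_{ω ∈ S_m} (P^B_m(ω) - Σ_{k=m}^{m+T} |E_k(ω)| μ^{-k}) ≤ m ε_T`.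
[cite: MadrasSlade1993, Theorem 8.3.1 (proof, eqs. (8.3.8), (8.3.11); quantitative form)] -/
private theorem tv_series_tail (d : ℕ) {m : ℕ} (hm : 1 ≤ m) (T : ℕ) :
    ∑ ω ∈ saws (d + 2) m, (kestenCyl (d + 2) m ω -
        ∑ k ∈ Icc m (m + T), (eCount (d + 2) k m ω : ℝ) / connectiveConstant (d + 2) ^ k) ≤
      (m : ℝ) * (1 - ∑ s ∈ Icc 1 T, (irreducibleBridgeCount (d + 2) s : ℝ) / connectiveConstant (d + 2) ^ s) := by
  set μ := connectiveConstant (d + 2) with hμdef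
  have hμ : 0 < μ := connectiveConstant_pos (d + 2)
  obtain ⟨M, hMdef⟩ : ∃ M : ℕ, M = m + T + 1 := ⟨_, rfl⟩
  set a : ℕ → ℝ := fun i => (bridgeCount (d + 2) i : ℝ) / μ ^ i with hadef
  set lam : ℕ → ℝ := fun k => (irreducibleBridgeCount (d + 2) k : ℝ) with hlamdef
  have hlam0' : ∀ j, 0 ≤ lam j := fun j => by simp only [hlamdef]; positivity
  have hlam00 : lam 0 = 0 := by simp [hlamdef]
  have ha0 : ∀ i, 0 ≤ a i := fun i => by simp only [hadef]; positivity
  have ha1 : ∀ i, a i ≤ 1 := fun i => bridgeCount_div_pow_le_one (d + 2) i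
  have hp : HasSum (fun s => lam s / μ ^ s) 1 := by
    simp only [hlamdef]; exact MadrasSlade1993_eq424_holds (d + 2)
  -- the ω-summed tail as a HasSum
  have hω : HasSum (fun k => ∑ ω ∈ saws (d + 2) m,
      (eCount (d + 2) (k + M) m ω : ℝ) / μ ^ (k + M))
      (∑ ω ∈ saws (d + 2) m, (kestenCyl (d + 2) m ω - ∑ k ∈ Icc m (m + T), (eCount (d + 2) k m ω : ℝ) / μ ^ k)) := by
    refine hasSum_sum fun ω hω => ?_
    rw [hMdef]
    exact hasSum_kestenCyl_tail d hm hω T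
  -- the same function written with the summed identity (8.3.8)
  set g : ℕ → ℕ → ℝ := fun i k => a i * (lam (k + (M - i)) / μ ^ (k + (M - i))) with hgdef
  have hfun : (fun k => ∑ ω ∈ saws (d + 2) m, (eCount (d + 2) (k + M) m ω : ℝ) / μ ^ (k + M)) =
      fun k => ∑ i ∈ Finset.range m, g i k := by
    funext k
    rw [← Finset.sum_div]
    have h := sum_eCount_eq (d + 2) (k + M) m hm (by omega)
    have h' : (∑ ω ∈ saws (d + 2) m, (eCount (d + 2) (k + M) m ω : ℝ)) =
        ∑ i ∈ Finset.range m, (bridgeCount (d + 2) i : ℝ) * (irreducibleBridgeCount (d + 2) (k + M - i) : ℝ) := by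
      exact_mod_cast h
    rw [h', Finset.sum_div]
    refine Finset.sum_congr rfl fun i hi => ?_
    have him : i < m := Finset.mem_range.1 hi
    simp only [hgdef, hadef, hlamdef]
    have hsplit : μ ^ (k + M) = μ ^ i * μ ^ (k + (M - i)) := by
      rw [← pow_add]; congr 1; omega
    have hμi : μ ^ i ≠ 0 := pow_ne_zero i hμ.ne'
    have hμr : μ ^ (k + (M - i)) ≠ 0 := pow_ne_zero _ hμ.ne'
    rw [show k + M - i = k + (M - i) by omega, hsplit]
    field_simp
  have hg : ∀ i ∈ Finset.range m,
      HasSum (g i) (a i * (1 - ∑ s ∈ Finset.range (M - i), lam s / μ ^ s)) := by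
    intro i _
    exact ((hasSum_nat_add_iff' (M - i)).2 hp).mul_left _
  have hG := hasSum_sum hg
  rw [hfun] at hω
  have heq := hω.unique hG
  rw [heq]
  -- bound each term by `a_i ε_T ≤ ε_T`
  have hrange_Icc : ∑ s ∈ Finset.range (T + 1), lam s / μ ^ s = ∑ s ∈ Icc 1 T, lam s / μ ^ s := by
    rw [Finset.range_eq_Ico, ← Finset.sum_Ico_consecutive _ (Nat.zero_le 1) (by omega : 1 ≤ T + 1),
      Finset.sum_Ico_eq_sum_range, show 1 - 0 = 1 by rfl, Finset.sum_range_one, SAW.MS831.Icc_eq_Ico_succ]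
    simp [hlam00]
  set εT : ℝ := 1 - ∑ s ∈ Icc 1 T, lam s / μ ^ s with hεTdef
  have hεT0 : 0 ≤ εT := by
    have := sum_irreducibleBridgeCount_div_pow_le_one (d + 2) (Icc 1 T)
    simp only [hεTdef, hlamdef]; linarith
  have hterm : ∀ i ∈ Finset.range m, a i * (1 - ∑ s ∈ Finset.range (M - i), lam s / μ ^ s) ≤ εT := by
    intro i hi
    have him : i < m := Finset.mem_range.1 hi
    have h1 : 1 - ∑ s ∈ Finset.range (M - i), lam s / μ ^ s ≤ εT := by
      rw [hεTdef, ← hrange_Icc]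
      have hsub : Finset.range (T + 1) ⊆ Finset.range (M - i) := Finset.range_subset_range.2 (by omega)
      have := Finset.sum_le_sum_of_subset_of_nonneg hsub fun s _ _ => show 0 ≤ lam s / μ ^ s by
        have := hlam0' s; positivity
      linarith
    have h2 : 0 ≤ 1 - ∑ s ∈ Finset.range (M - i), lam s / μ ^ s := by
      have := sum_irreducibleBridgeCount_div_pow_le_one (d + 2) (Finset.range (M - i))
      simp only [hlamdef]; linarith
    calc a i * (1 - ∑ s ∈ Finset.range (M - i), lam s / μ ^ s)
        ≤ 1 * (1 - ∑ s ∈ Finset.range (M - i), lam s / μ ^ s) := mul_le_mul_of_nonneg_right (ha1 i) h2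
      _ ≤ εT := by rw [one_mul]; exact h1
  calc ∑ i ∈ Finset.range m, a i * (1 - ∑ s ∈ Finset.range (M - i), lam s / μ ^ s)
      ≤ ∑ i ∈ Finset.range m, εT := Finset.sum_le_sum hterm
    _ = (m : ℝ) * εT := by rw [Finset.sum_const, Finset.card_range, nsmul_eq_mul]

/-- The `ω`-summed far tail of `P^B_{m,n}` ((8.3.9) summed): with the summed (8.3.8),
`Σ_ω Σ_{k > m+T} |E_k(ω)| b_{n-k}/b_n = Σ_{i<m} b_i Σ_{k>m+T} λ_{k-i} b_{n-k}/b_n ≤ 2 m (ε_T + Θ)`.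
[cite: MadrasSlade1993, Theorem 8.3.1 (proof, eqs. (8.3.8)–(8.3.9); quantitative form)] -/
private theorem tv_bridge_tail (d : ℕ) {K₀ : ℝ} (hK₀ : 0 ≤ K₀) {N₀ : ℕ}
    (hL : ∀ n : ℕ, N₀ ≤ n → ∀ k : ℕ, k ^ 5 ≤ n →
      |connectiveConstant (d + 2) ^ k * (bridgeCount (d + 2) (n - k) : ℝ) / bridgeCount (d + 2) n - 1| ≤
        K₀ * ((k : ℝ) * (n : ℝ) ^ (-(1 : ℝ) / 4) + 1 / Real.log n))
    {m n T : ℕ} (hm : 1 ≤ m) (hn : 2 ≤ n) (hmn4 : 2 * m + 4 ≤ n) (hN₀ : N₀ + m ≤ n) (hT5 : T ^ 5 + m ≤ n)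
    (hTm : T + m + 1 ≤ n) (hTy : (T : ℝ) ≤ (n : ℝ) ^ ((1 : ℝ) / 5))
    {Θ : ℝ} (hΘ : K₀ * (2 * (n : ℝ) ^ (-((1 : ℝ) / 20)) + 2 / Real.log n) ≤ Θ) (hΘhalf : Θ ≤ 1 / 2)
    (hq : ∀ i, i ≤ m →
      |connectiveConstant (d + 2) ^ i * (bridgeCount (d + 2) (n - i) : ℝ) / bridgeCount (d + 2) n - 1| ≤ Θ) :
    ∑ ω ∈ saws (d + 2) m, (∑ k ∈ Ico (m + T + 1) (n + 1),
        (eCount (d + 2) k m ω : ℝ) * bridgeCount (d + 2) (n - k)) / bridgeCount (d + 2) n ≤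
      2 * (m : ℝ) * ((1 - ∑ s ∈ Icc 1 T, (irreducibleBridgeCount (d + 2) s : ℝ) / connectiveConstant (d + 2) ^ s) + Θ) := by
  set μ := connectiveConstant (d + 2) with hμdef
  have hμ : 0 < μ := connectiveConstant_pos (d + 2)
  have hb : ∀ k, (0 : ℝ) < bridgeCount (d + 2) k := fun k => by
    exact_mod_cast one_le_bridgeCount (d := d + 2) k
  set bb : ℕ → ℝ := fun k => (bridgeCount (d + 2) k : ℝ) with hbbdef
  set lam : ℕ → ℝ := fun k => (irreducibleBridgeCount (d + 2) k : ℝ) with hlamdef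
  set εT : ℝ := 1 - ∑ s ∈ Icc 1 T, lam s / μ ^ s with hεTdef
  have hbb : ∀ k, 0 < bb k := fun k => hb k
  have hlam0' : ∀ j, 0 ≤ lam j := fun j => by simp only [hlamdef]; positivity
  have hlam00 : lam 0 = 0 := by simp [hlamdef]
  have hren : ∀ n', 1 ≤ n' → bb n' = ∑ s ∈ Icc 1 n', lam s * bb (n' - s) := fun n' hn' => by
    simp only [hbbdef, hlamdef]; exact bridgeCount_eq_sum_Icc_real (d := d + 2) hn'
  have hεT0 : 0 ≤ εT := by
    have := sum_irreducibleBridgeCount_div_pow_le_one (d + 2) (Icc 1 T)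
    simp only [hεTdef, hlamdef]; linarith
  have hΘ0 : 0 ≤ Θ := le_trans (by
    have hn0 : (0:ℝ) < n := by exact_mod_cast (show 0 < n by omega)
    have : 0 ≤ Real.log n := Real.log_natCast_nonneg n
    positivity) hΘ
  -- exchange the sums and use the summed (8.3.8)
  have hswap : ∑ ω ∈ saws (d + 2) m, (∑ k ∈ Ico (m + T + 1) (n + 1),
      (eCount (d + 2) k m ω : ℝ) * bb (n - k)) / bb n =
      ∑ i ∈ Finset.range m, (bridgeCount (d + 2) i : ℝ) *
        ((∑ k ∈ Ico (m + T + 1) (n + 1), lam (k - i) * bb (n - k)) / bb n) := by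
    rw [← Finset.sum_div, Finset.sum_comm]
    have h1 : ∑ k ∈ Ico (m + T + 1) (n + 1), ∑ ω ∈ saws (d + 2) m, (eCount (d + 2) k m ω : ℝ) * bb (n - k) =
        ∑ k ∈ Ico (m + T + 1) (n + 1), ∑ i ∈ Finset.range m,
          (bridgeCount (d + 2) i : ℝ) * (lam (k - i) * bb (n - k)) := by
      refine Finset.sum_congr rfl fun k hk => ?_
      have hkm : m ≤ k := by have := (Finset.mem_Ico.1 hk).1; omega
      rw [← Finset.sum_mul]
      have h := sum_eCount_eq (d + 2) k m hm hkm
      have h' : (∑ ω ∈ saws (d + 2) m, (eCount (d + 2) k m ω : ℝ)) =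
          ∑ i ∈ Finset.range m, (bridgeCount (d + 2) i : ℝ) * (irreducibleBridgeCount (d + 2) (k - i) : ℝ) := by
        exact_mod_cast h
      rw [h', Finset.sum_mul]
      refine Finset.sum_congr rfl fun i _ => ?_
      simp only [hlamdef]; ring
    rw [h1, Finset.sum_comm, Finset.sum_div]
    refine Finset.sum_congr rfl fun i _ => ?_
    rw [← Finset.mul_sum, mul_div_assoc]
  rw [hswap]
  -- per `i`: (8.3.9) inner step, then the quantified remainder term
  have hterm : ∀ i ∈ Finset.range m, (bridgeCount (d + 2) i : ℝ) *
      ((∑ k ∈ Ico (m + T + 1) (n + 1), lam (k - i) * bb (n - k)) / bb n) ≤ 2 * (εT + Θ) := by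
    intro i hi
    have him : i < m := Finset.mem_range.1 hi
    have hshift := SAW.MS831.sum_shift_tail_le (m := m) hbb hlam0' hlam00 hren (T := T) (n := n) (i := i)
      (by omega) (by omega)
    have hrem := remainder_term_bound d hK₀ hL (n := n) (i := i) (T := T) hn (by omega) (by omega) (by omega)
      (by omega) hTy hΘ hΘhalf (hq i (by omega))
    have h1 : (∑ k ∈ Ico (m + T + 1) (n + 1), lam (k - i) * bb (n - k)) / bb n ≤ (μ ^ i)⁻¹ * (2 * (εT + Θ)) := by
      refine le_trans (div_le_div_of_nonneg_right hshift (hbb n).le) ?_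
      simpa only [hbbdef, hlamdef, hεTdef] using hrem
    have hai : (bridgeCount (d + 2) i : ℝ) * (μ ^ i)⁻¹ ≤ 1 := by
      have := bridgeCount_div_pow_le_one (d + 2) i
      rwa [div_eq_mul_inv] at this
    have hbi : (0 : ℝ) ≤ bridgeCount (d + 2) i := by positivity
    calc (bridgeCount (d + 2) i : ℝ) * ((∑ k ∈ Ico (m + T + 1) (n + 1), lam (k - i) * bb (n - k)) / bb n)
        ≤ (bridgeCount (d + 2) i : ℝ) * ((μ ^ i)⁻¹ * (2 * (εT + Θ))) := mul_le_mul_of_nonneg_left h1 hbi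
      _ = (bridgeCount (d + 2) i : ℝ) * (μ ^ i)⁻¹ * (2 * (εT + Θ)) := by ring
      _ ≤ 1 * (2 * (εT + Θ)) := mul_le_mul_of_nonneg_right hai (by positivity)
      _ = 2 * (εT + Θ) := one_mul _
  calc ∑ i ∈ Finset.range m, (bridgeCount (d + 2) i : ℝ) *
        ((∑ k ∈ Ico (m + T + 1) (n + 1), lam (k - i) * bb (n - k)) / bb n)
      ≤ ∑ i ∈ Finset.range m, 2 * (εT + Θ) := Finset.sum_le_sum hterm
    _ = 2 * (m : ℝ) * (εT + Θ) := by rw [Finset.sum_const, Finset.card_range, nsmul_eq_mul]; ring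

/-- The regime estimate for the total-variation form: `Σ_ω |P^B_{m,n}(ω) - P^B_m(ω)| ≤ (m+1)(84 K₀ + 60)/log n`.
[cite: MadrasSlade1993, Theorem 8.3.1 (proof; quantitative form, derived)] -/
private theorem regime_bound_TV (d : ℕ) {K₀ : ℝ} (hK₀ : 0 ≤ K₀) {N₀ : ℕ}
    (hL : ∀ n : ℕ, N₀ ≤ n → ∀ k : ℕ, k ^ 5 ≤ n →
      |connectiveConstant (d + 2) ^ k * (bridgeCount (d + 2) (n - k) : ℝ) / bridgeCount (d + 2) n - 1| ≤
        K₀ * ((k : ℝ) * (n : ℝ) ^ (-(1 : ℝ) / 4) + 1 / Real.log n))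
    {m n : ℕ} (hm : 1 ≤ m) (hmn : m ≤ n) (hn : 2 ≤ n)
    (h1 : 2 * N₀ + 4 ≤ n) (h2 : 10 * Real.log (4 * connectiveConstant (d + 2)) ≤ Real.log n)
    (h3 : 4 * connectiveConstant (d + 2) ≤ (n : ℝ) ^ ((1 : ℝ) / 5))
    (h4 : K₀ * (2 * (n : ℝ) ^ (-((1 : ℝ) / 20)) + 2 / Real.log n) ≤ 1 / 2)
    (hmJ : 2 * (m + 1) ≤ ⌊(n : ℝ) ^ ((1 : ℝ) / 5)⌋₊) :
    ∑ ω ∈ saws (d + 2) m,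
        |(bridgeExtCount (d + 2) n m ω : ℝ) / bridgeCount (d + 2) n - kestenCyl (d + 2) m ω| ≤
      ((m : ℝ) + 1) * (84 * K₀ + 60) / Real.log n := by
  set μ := connectiveConstant (d + 2) with hμdef
  have hμ2 : 2 ≤ μ := by
    have h := natCast_le_connectiveConstant (d + 2)
    have : (2 : ℝ) ≤ ((d + 2 : ℕ) : ℝ) := by exact_mod_cast (show 2 ≤ d + 2 by omega)
    exact this.trans h
  have hμ : 0 < μ := by linarith
  have hb : ∀ k, (0 : ℝ) < bridgeCount (d + 2) k := fun k => by
    exact_mod_cast one_le_bridgeCount (d := d + 2) k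
  have hn0 : (0 : ℝ) < n := by exact_mod_cast (show 0 < n by omega)
  have hlogn : 0 < Real.log n := Real.log_pos (by exact_mod_cast (show 1 < n by omega))
  have hm0 : (0 : ℝ) ≤ m := Nat.cast_nonneg m
  set J : ℕ := ⌊(n : ℝ) ^ ((1 : ℝ) / 5)⌋₊ with hJdef
  set y : ℝ := (n : ℝ) ^ ((1 : ℝ) / 5) with hydef
  have hy2 : 2 ≤ y := by linarith
  have hy0 : 0 < y := by linarith
  have hy5 : y ^ 5 = n := by
    rw [hydef, show ((1 : ℝ) / 5) = ((5 : ℕ) : ℝ)⁻¹ by norm_num]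
    exact Real.rpow_inv_natCast_pow hn0.le (by norm_num)
  have hJy : (J : ℝ) ≤ y := Nat.floor_le hy0.le
  have hJ5 : J ^ 5 ≤ n := by
    have : (J : ℝ) ^ 5 ≤ y ^ 5 := pow_le_pow_left₀ (Nat.cast_nonneg J) hJy 5
    rw [hy5] at this; exact_mod_cast this
  have h16J : 16 * J ≤ n := by
    have hy16 : 16 * y ≤ y ^ 5 := by
      have h16 : (2 : ℝ) ^ 4 ≤ y ^ 4 := pow_le_pow_left₀ (by norm_num) hy2 4
      nlinarith
    have : 16 * (J : ℝ) ≤ n := by rw [← hy5]; linarith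
    exact_mod_cast this
  set T : ℕ := J - m with hTdef
  have hJmT : m + T = J := by omega
  have hT1 : 1 ≤ T := by omega
  have hTJ : (J : ℝ) ≤ 2 * T := by exact_mod_cast (show J ≤ 2 * T by omega)
  have hyJ : y < J + 1 := Nat.lt_floor_add_one y
  have hTy : y / 4 ≤ T := by linarith
  have hμT : μ ≤ T := by linarith
  have hTJle : T ≤ J := by omega
  have hT5J : T ^ 5 + J ≤ J ^ 5 := by
    obtain ⟨a, ha⟩ : ∃ a, J = a + 1 := ⟨J - 1, by omega⟩
    have hTa : T ≤ a := by omega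
    have h1' : T ^ 5 ≤ a ^ 5 := Nat.pow_le_pow_left hTa 5
    have h2' : (a + 1) ^ 5 = a ^ 5 + a + 1 + (5 * a ^ 4 + 10 * a ^ 3 + 10 * a ^ 2 + 4 * a) := by ring
    rw [ha, h2']; omega
  set Θ : ℝ := K₀ * (2 * (n : ℝ) ^ (-((1 : ℝ) / 20)) + 2 / Real.log n) with hΘdef
  have hr20 : 0 ≤ (n : ℝ) ^ (-((1 : ℝ) / 20)) := Real.rpow_nonneg hn0.le _
  have hr4 : 0 ≤ (n : ℝ) ^ (-(1 : ℝ) / 4) := Real.rpow_nonneg hn0.le _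
  have hΘ0 : 0 ≤ Θ := by positivity
  have hyr : y * (n : ℝ) ^ (-(1 : ℝ) / 4) = (n : ℝ) ^ (-((1 : ℝ) / 20)) := by
    rw [hydef, ← Real.rpow_add hn0]; norm_num
  have hq : ∀ k, k ≤ J →
      |μ ^ k * (bridgeCount (d + 2) (n - k) : ℝ) / bridgeCount (d + 2) n - 1| ≤ Θ := by
    intro k hk
    have hk5 : k ^ 5 ≤ n := le_trans (Nat.pow_le_pow_left hk 5) hJ5
    refine (hL n (by omega) k hk5).trans ?_
    rw [hΘdef]
    refine mul_le_mul_of_nonneg_left ?_ hK₀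
    have hky : (k : ℝ) ≤ y := le_trans (by exact_mod_cast hk) hJy
    have hkr : (k : ℝ) * (n : ℝ) ^ (-(1 : ℝ) / 4) ≤ (n : ℝ) ^ (-((1 : ℝ) / 20)) := by
      rw [← hyr]; exact mul_le_mul_of_nonneg_right hky hr4
    have hl0 : 0 ≤ 1 / Real.log n := by positivity
    have hA : (k : ℝ) * (n : ℝ) ^ (-(1 : ℝ) / 4) + 1 / Real.log n ≤
        (n : ℝ) ^ (-((1 : ℝ) / 20)) + 1 / Real.log n := add_le_add hkr le_rfl
    have hB : (n : ℝ) ^ (-((1 : ℝ) / 20)) + 1 / Real.log n ≤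
        2 * (n : ℝ) ^ (-((1 : ℝ) / 20)) + 2 / Real.log n := by
      have : 2 / Real.log n = 2 * (1 / Real.log n) := by ring
      rw [this]; linarith
    exact hA.trans hB
  set εT : ℝ := 1 - ∑ s ∈ Icc 1 T, (irreducibleBridgeCount (d + 2) s : ℝ) / μ ^ s with hεTdef
  have hεT_le : εT ≤ 20 / Real.log n :=
    kestenTail_le_twenty_div_log d hn hT1 hμT (by linarith) h2
  have hεT0 : 0 ≤ εT := by
    have := sum_irreducibleBridgeCount_div_pow_le_one (d + 2) (Icc 1 T)
    rw [hεTdef]; linarith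
  -- per-ω decomposition: `|D(ω)| ≤ Sinf(ω)·Θ + tail1(ω) + tail(ω)`
  set e : (ℕ → Site (d + 2)) → ℕ → ℝ := fun ω k => (eCount (d + 2) k m ω : ℝ) with hedef
  have he0 : ∀ ω k, 0 ≤ e ω k := fun ω k => by simp only [hedef]; positivity
  have hdecomp : ∀ ω ∈ saws (d + 2) m,
      |(bridgeExtCount (d + 2) n m ω : ℝ) / bridgeCount (d + 2) n - kestenCyl (d + 2) m ω| ≤
        (∑ k ∈ Icc m (m + T), e ω k / μ ^ k) * Θ +
          (∑ k ∈ Ico (m + T + 1) (n + 1), e ω k * bridgeCount (d + 2) (n - k)) / bridgeCount (d + 2) n +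
          (kestenCyl (d + 2) m ω - ∑ k ∈ Icc m (m + T), e ω k / μ ^ k) := by
    intro ω hω
    have h835 : (bridgeExtCount (d + 2) n m ω : ℝ) =
        ∑ k ∈ Icc m n, e ω k * bridgeCount (d + 2) (n - k) := by
      have := bridgeExtCount_eq_sum_eCount n m hmn ω
      simp only [hedef]; exact_mod_cast this
    have hsplit : ∑ k ∈ Icc m n, e ω k * bridgeCount (d + 2) (n - k) =
        ∑ k ∈ Icc m (m + T), e ω k * bridgeCount (d + 2) (n - k) +
          ∑ k ∈ Ico (m + T + 1) (n + 1), e ω k * bridgeCount (d + 2) (n - k) := by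
      rw [SAW.MS831.Icc_eq_Ico_succ, SAW.MS831.Icc_eq_Ico_succ]
      exact (Finset.sum_Ico_consecutive _ (by omega) (by omega)).symm
    have hhead := head_bound d (m := m) (T := T) (n := n) (ω := ω) (fun k hk => hq k (by omega))
    have htail0 := (kestenCyl_sub_partial d hm hω T).1
    have htail1_0 : 0 ≤ (∑ k ∈ Ico (m + T + 1) (n + 1), e ω k * bridgeCount (d + 2) (n - k)) /
        bridgeCount (d + 2) n := by
      refine div_nonneg (Finset.sum_nonneg fun k _ => ?_) (hb n).le
      have := he0 ω k; have := hb (n - k); positivity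
    rw [h835, hsplit, add_div]
    have habs := abs_le.1 hhead
    simp only [hedef] at habs htail0 htail1_0 ⊢
    rw [abs_le]
    constructor <;> linarith
  -- sum the three pieces
  have hS1 : ∑ ω ∈ saws (d + 2) m, (∑ k ∈ Icc m (m + T), e ω k / μ ^ k) * Θ ≤ Θ := by
    rw [← Finset.sum_mul]
    have hle : ∑ ω ∈ saws (d + 2) m, ∑ k ∈ Icc m (m + T), e ω k / μ ^ k ≤
        ∑ ω ∈ saws (d + 2) m, kestenCyl (d + 2) m ω :=
      Finset.sum_le_sum fun ω hω => by
        have := (kestenCyl_sub_partial d hm hω T).1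
        simp only [hedef]; linarith
    rw [sum_kestenCyl_eq_one (d + 2) m hm] at hle
    calc (∑ ω ∈ saws (d + 2) m, ∑ k ∈ Icc m (m + T), e ω k / μ ^ k) * Θ ≤ 1 * Θ :=
          mul_le_mul_of_nonneg_right hle hΘ0
      _ = Θ := one_mul Θ
  have hS2 : ∑ ω ∈ saws (d + 2) m,
      (∑ k ∈ Ico (m + T + 1) (n + 1), e ω k * bridgeCount (d + 2) (n - k)) / bridgeCount (d + 2) n ≤
        2 * (m : ℝ) * (εT + Θ) := by
    have h := tv_bridge_tail d hK₀ hL (m := m) (n := n) (T := T) hm hn (by omega) (by omega) (by omega) (by omega)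
      (le_trans (by exact_mod_cast hTJle) hJy) (le_of_eq hΘdef.symm) h4 (fun i hi => hq i (by omega))
    simpa only [hedef, hεTdef] using h
  have hS3 : ∑ ω ∈ saws (d + 2) m, (kestenCyl (d + 2) m ω - ∑ k ∈ Icc m (m + T), e ω k / μ ^ k) ≤
      (m : ℝ) * εT := by
    have h := tv_series_tail d hm T
    simpa only [hedef, hεTdef] using h
  have hsum : ∑ ω ∈ saws (d + 2) m,
      |(bridgeExtCount (d + 2) n m ω : ℝ) / bridgeCount (d + 2) n - kestenCyl (d + 2) m ω| ≤
        Θ + 2 * (m : ℝ) * (εT + Θ) + (m : ℝ) * εT := by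
    refine (Finset.sum_le_sum hdecomp).trans ?_
    rw [Finset.sum_add_distrib, Finset.sum_add_distrib]
    linarith
  refine hsum.trans ?_
  -- `Θ ≤ 42 K₀/log n`, `εT ≤ 20/log n`
  have h20 : (n : ℝ) ^ (-((1 : ℝ) / 20)) ≤ 20 / Real.log n := rpow_neg_twentieth_le' hn
  have hΘb : Θ ≤ 42 * K₀ / Real.log n := by
    rw [hΘdef]
    calc K₀ * (2 * (n : ℝ) ^ (-((1 : ℝ) / 20)) + 2 / Real.log n)
        ≤ K₀ * (2 * (20 / Real.log n) + 2 / Real.log n) := by gcongr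
      _ = 42 * K₀ / Real.log n := by ring
  have hK0' : 0 ≤ 42 * K₀ / Real.log n := by positivity
  have h20' : (0 : ℝ) ≤ 20 / Real.log n := by positivity
  calc Θ + 2 * (m : ℝ) * (εT + Θ) + (m : ℝ) * εT
      ≤ 42 * K₀ / Real.log n + 2 * (m : ℝ) * (20 / Real.log n + 42 * K₀ / Real.log n) +
          (m : ℝ) * (20 / Real.log n) := by
        have h1' : 2 * (m : ℝ) * (εT + Θ) ≤ 2 * (m : ℝ) * (20 / Real.log n + 42 * K₀ / Real.log n) :=
          mul_le_mul_of_nonneg_left (by linarith) (by positivity)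
        have h2' : (m : ℝ) * εT ≤ (m : ℝ) * (20 / Real.log n) := mul_le_mul_of_nonneg_left hεT_le hm0
        linarith
    _ = ((m : ℝ) * (84 * K₀ + 60) + 42 * K₀) / Real.log n := by ring
    _ ≤ ((m : ℝ) + 1) * (84 * K₀ + 60) / Real.log n := by
        refine div_le_div_of_nonneg_right ?_ hlogn.le
        nlinarith

/-- **Madras–Slade Theorem 8.3.1 with a rate, total-variation form (quantitative weak convergence of the
first `m` steps of a uniform `n`-bridge to Kesten's infinite-bridge measure), every dimension `d + 2 ≥ 2`:**
there is `K` such that for all `m ≤ n`, `n ≥ 2`,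
`Σ_{ω ∈ S_m} |P^B_{m,n}(ω) - P^B_m(ω)| ≤ K (m+1)/log n`.
[cite: MadrasSlade1993, Theorem 8.3.1 (p. 273) (quantitative form, derived)] -/
theorem kestenCyl_rate_TV (d : ℕ) :
    ∃ K : ℝ, ∀ m n : ℕ, m ≤ n → 2 ≤ n →
      ∑ ω ∈ saws (d + 2) m,
          |(bridgeExtCount (d + 2) n m ω : ℝ) / bridgeCount (d + 2) n - kestenCyl (d + 2) m ω| ≤
        K * (m + 1) / Real.log n := by
  set μ := connectiveConstant (d + 2) with hμdef
  have hμ2 : 2 ≤ μ := by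
    have h := natCast_le_connectiveConstant (d + 2)
    have : (2 : ℝ) ≤ ((d + 2 : ℕ) : ℝ) := by exact_mod_cast (show 2 ≤ d + 2 by omega)
    exact this.trans h
  have hμ : 0 < μ := by linarith
  obtain ⟨K₀, hK₀, N₀, hL⟩ := ratio_uniform d
  have hb : ∀ k, (0 : ℝ) < bridgeCount (d + 2) k := fun k => by
    exact_mod_cast one_le_bridgeCount (d := d + 2) k
  -- thresholds in `n` (as in `kestenCyl_rate`)
  have hev1 : ∀ᶠ n : ℕ in atTop, 2 * N₀ + 4 ≤ n := eventually_ge_atTop _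
  have hev2 : ∀ᶠ n : ℕ in atTop, 10 * Real.log (4 * μ) ≤ Real.log n :=
    (Real.tendsto_log_atTop.comp tendsto_natCast_atTop_atTop).eventually_ge_atTop _
  have hev3 : ∀ᶠ n : ℕ in atTop, 4 * μ ≤ (n : ℝ) ^ ((1 : ℝ) / 5) :=
    ((tendsto_rpow_atTop (by norm_num : (0 : ℝ) < 1 / 5)).comp tendsto_natCast_atTop_atTop).eventually_ge_atTop _
  have ht0 : Tendsto (fun n : ℕ => (n : ℝ) ^ (-((1 : ℝ) / 20))) atTop (𝓝 0) :=
    (tendsto_rpow_neg_atTop (by norm_num : (0 : ℝ) < 1 / 20)).comp tendsto_natCast_atTop_atTop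
  have hlt : Tendsto (fun n : ℕ => Real.log (n : ℝ)) atTop atTop :=
    Real.tendsto_log_atTop.comp tendsto_natCast_atTop_atTop
  have htl : Tendsto (fun n : ℕ => 1 / Real.log n) atTop (𝓝 0) := by
    refine (hlt.inv_tendsto_atTop).congr fun n => ?_
    simp only [Pi.inv_apply, one_div]
  have hΘt : Tendsto (fun n : ℕ => K₀ * (2 * (n : ℝ) ^ (-((1 : ℝ) / 20)) + 2 / Real.log n)) atTop (𝓝 0) := by
    have h1 : Tendsto (fun n : ℕ => 2 * (n : ℝ) ^ (-((1 : ℝ) / 20)) + 2 * (1 / Real.log n)) atTop (𝓝 0) := by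
      simpa using (ht0.const_mul 2).add (htl.const_mul 2)
    have h2 := h1.const_mul K₀
    simp only [mul_zero] at h2
    refine h2.congr fun n => ?_
    ring
  have hev4 : ∀ᶠ n : ℕ in atTop, K₀ * (2 * (n : ℝ) ^ (-((1 : ℝ) / 20)) + 2 / Real.log n) ≤ 1 / 2 :=
    hΘt.eventually (ge_mem_nhds (by norm_num : (0 : ℝ) < 1 / 2))
  obtain ⟨N₁, hN₁⟩ := eventually_atTop.1 (((hev1.and hev2).and hev3).and hev4)
  have hN₁2 : 2 ≤ N₁ := by
    have := (((hN₁ N₁ le_rfl).1).1).1; omega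
  have hlogN₁ : 0 ≤ Real.log N₁ := Real.log_natCast_nonneg N₁
  set C : ℝ := 84 * K₀ + 60 with hCdef
  have hC0 : 0 ≤ C := by positivity
  refine ⟨20 + 2 * Real.log N₁ + C, fun m n hmn hn => ?_⟩
  have hn0 : (0 : ℝ) < n := by exact_mod_cast (show 0 < n by omega)
  have hlogn : 0 < Real.log n := Real.log_pos (by exact_mod_cast (show 1 < n by omega))
  have hm0 : (0 : ℝ) ≤ m := Nat.cast_nonneg m
  have hK0 : 0 ≤ 20 + 2 * Real.log N₁ + C := by positivity
  -- `m = 0`: every term vanishes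
  rcases Nat.eq_zero_or_pos m with rfl | hm
  · have hz : ∀ ω ∈ saws (d + 2) 0,
        |(bridgeExtCount (d + 2) n 0 ω : ℝ) / bridgeCount (d + 2) n - kestenCyl (d + 2) 0 ω| = 0 := by
      intro ω hω
      rw [bridgeExtCount_zero_left n hω, div_self (hb n).ne', kestenCyl_zero_left hω, sub_self, abs_zero]
    rw [Finset.sum_congr rfl hz, Finset.sum_const_zero]
    positivity
  -- the trivial bound `Σ |D| ≤ 2`
  have hD2 : ∑ ω ∈ saws (d + 2) m,
      |(bridgeExtCount (d + 2) n m ω : ℝ) / bridgeCount (d + 2) n - kestenCyl (d + 2) m ω| ≤ 2 := by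
    have hle : ∀ ω ∈ saws (d + 2) m,
        |(bridgeExtCount (d + 2) n m ω : ℝ) / bridgeCount (d + 2) n - kestenCyl (d + 2) m ω| ≤
          bridgeCylProb (d + 2) m n ω + kestenCyl (d + 2) m ω := by
      intro ω hω
      have h1 := bridgeCylProb_mem_Icc (d := d + 2) m n ω
      have h2 := kestenCyl_mem_Icc hm hω
      rw [bridgeCylProb] at h1 ⊢
      rw [abs_le]; constructor <;> linarith [h1.1, h2.1]
    refine (Finset.sum_le_sum hle).trans ?_
    rw [Finset.sum_add_distrib, sum_bridgeCylProb_eq_one (d + 2) n m hmn, sum_kestenCyl_eq_one (d + 2) m hm]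
    norm_num
  set J : ℕ := ⌊(n : ℝ) ^ ((1 : ℝ) / 5)⌋₊ with hJdef
  by_cases hreg : N₁ ≤ n ∧ 2 * (m + 1) ≤ J
  swap
  · refine hD2.trans ?_
    rw [le_div_iff₀ hlogn]
    rw [not_and_or] at hreg
    rcases hreg with hsmall | hbigm
    · have hnN : Real.log n ≤ Real.log N₁ :=
        Real.log_le_log hn0 (by exact_mod_cast (show n ≤ N₁ by omega))
      have h1 : (20 + 2 * Real.log N₁ + C) * 1 ≤ (20 + 2 * Real.log N₁ + C) * ((m : ℝ) + 1) :=
        mul_le_mul_of_nonneg_left (by linarith) hK0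
      nlinarith
    · -- `log n < 10 log(m+2) ≤ 10 (m+1)`
      have hylt : (n : ℝ) ^ ((1 : ℝ) / 5) < 2 * ((m : ℝ) + 2) := by
        have hf := Nat.lt_floor_add_one ((n : ℝ) ^ ((1 : ℝ) / 5))
        have hJ' : (J : ℝ) + 1 ≤ 2 * (m : ℝ) + 3 := by exact_mod_cast (show J + 1 ≤ 2 * m + 3 by omega)
        rw [← hJdef] at hf; linarith
      have hy0 : 0 < (n : ℝ) ^ ((1 : ℝ) / 5) := Real.rpow_pos_of_pos hn0 _
      have hlog2 : 0 < Real.log 2 := Real.log_pos (by norm_num)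
      have hlogm : Real.log ((m : ℝ) + 2) ≤ (m : ℝ) + 1 := by
        have := Real.log_le_sub_one_of_pos (show (0 : ℝ) < (m : ℝ) + 2 by positivity)
        linarith
      have hA : Real.log n < 10 * ((m : ℝ) + 1) := by
        have hl := Real.log_lt_log hy0 hylt
        rw [Real.log_rpow hn0, Real.log_mul (by norm_num) (by positivity)] at hl
        have : Real.log 2 ≤ Real.log ((m : ℝ) + 2) := Real.log_le_log (by norm_num) (by linarith)
        nlinarith
      have hB : 0 ≤ (2 * Real.log N₁ + C) * ((m : ℝ) + 1) := by positivity
      nlinarith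
  obtain ⟨hnN₁, hmJ⟩ := hreg
  obtain ⟨⟨⟨h1, h2⟩, h3⟩, h4⟩ := hN₁ n hnN₁
  have h := regime_bound_TV d hK₀ hL hm hmn hn h1 h2 h3 h4 hmJ
  refine h.trans ?_
  rw [div_le_div_iff₀ hlogn hlogn]
  have : ((m : ℝ) + 1) * C ≤ (20 + 2 * Real.log N₁ + C) * ((m : ℝ) + 1) := by nlinarith
  exact mul_le_mul_of_nonneg_right (by linarith) hlogn.le

end Literature.Probability.RandomPlanarGeometry.SAW.Zd

end
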